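import Summits.QuantumFields.YangMills.Theorems.BalabanUVNodesN15TwoSpacingGluingGradientGluedDefectCubes
import Summits.QuantumFields.YangMills.Theorems.BalabanUVNodesN15CurvedGluingSmoothCutDressedGluedDefectGaugedUN
import HarnessLib

/-!
# THE GLUING STEP AT TWO LATTICE SPACINGS — THE GRADIENT ENTRIES OF THE GLUED LIVE-BACKGROUND PROPAGATOR, II: the two-spacing η-defect of every flat jet component `∇^±_μ𝒢` of the glued
# operator of Bałaban's `Δ_{R_U} + P` from dressed smooth-cut cubes IN THE GLOBAL GAUGE (`u ≡ 1 ≡ u′`) — dag-n15-w3 53 with `∇^±_μ∘` in front, the cube perturbations = the species of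
# the bond variables cut to the cube, covariance identities and far-defect rows discharged (dag-n15-c g17, FILE 137; N15 = NE2, s1 «background-layer OPERATOR ingredient»)

Cell `pub-ymgap`, seat `pub-ymgap-dag-n15-c` (R134 (a); HUMAN RULING D-0062), generation 17.  `bears_on: R4∕N15 · K3⁸ SpineGivenEndpointR13SepCoPHV (stmt-QuantumFields-27366)`.
Filed `--kind proof --supports stmt-QuantumFields-27366 --as helper` — COUNT-NEUTRAL.  Theorems only; 0 `def`, 0 `sorry`.  Imports BY NAME FILE 137a `…TwoSpacingGluingGradientGluedDefectCubes`
(`hasMaj_idef_jet_glueInv_smoothCutDressed_cubes`) and dag-n15-w3 53 `…CurvedGluingSmoothCutDressedGluedDefectGaugedUN` (`uN_localOp_eq_cut_add_farDefect`; through it 49∕50∕51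
`hasMaj(_idef)_mulOp_farDefect_smoothCutDressed(_structural)`, `hasMaj(_idef)_commOp_farDefect_structural`, `hasMaj(_idef)_cutPert_structural_of_local`, dag-n15-w2 `uN_localOp_species_form`,
`coordMat_conj_one`, `mmulOp_one`).  Nothing in the tree is modified, no landed name re-declared.

WHY.  dag-n15-w3 53 (`uN_hasMaj_idef_glueInv_smoothCutDressed_localGauges`) is the `U(m)`-level two-grid capstone behind FILES 123∕130 (entry 0 of the live-background family): per cube a
unitary site gauge `u_k`, the transformed bond variables' species cut to the cube, the covariance identity and the far-defect rows discharged, 48 called once.  g16 located that the honest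
sub-class of (3.35) for the FLAT nonlocal summand is the GLOBAL gauge `u ≡ 1` ([Balaban1985BackgroundPropagators] (3.26) is covariant + nonlocal), and at `u ≡ 1` the flat jet `∇^±_μ`
passes the (trivial) gauge sandwiches.  THIS FILE is 53 at `u ≡ 1 ≡ u′` with `∇^±_j∘` in front: the sandwiches `M_{W}`, `M_{Wᵀ}` at `w ≡ 1` are the identity (`coordMat_conj_one`, `mmulOp_one`)
and are removed from the goal and from both covariance identities; 53's sixteen discharges run verbatim at `u ≡ 1`; then ONE application of FILE 137a.  Binders = 53's minus the unitarity
rows `hu, hu′` and the gauge fit `o_W`; the species are written in 53's literal shape at `u = 1` (`1·U_μ(x)·1ᴴ`), `P`'s law as `M_W P M_{Wᵀ} = N_L − N_V k` at `w ≡ 1` — so that the cover's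
glued operators `cvGlued′ … 1 …`, `cvGlued … 1 …` (FILES 119∕123a) unfold to the two operands literally.

WHAT.  ★★★ `one_hasMaj_idef_jet_glueInv_smoothCutDressed`: `𝔇_π(∇′_j∘𝒢′, ∇_j∘𝒢) ≤ K·e^{−(ρ₃−2σ)d}` for every jet index `j = ±μ`, `K` = FILE 137a's kernel at 53's letters
(`n = η⁻¹`, `n′ = η′⁻¹`, `θ_F ↦ θ_F·1·β̄′c_r`, `ε_F = 0`, `r_{FK} ↦ θ_F(A_D + β̄′oo)c_r + r_Dβ̄′c_r`, `r_{FE} = 0`) — written out below (the cover instantiates it and bounds it by a certificate).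

HONEST FRAMING ∕ LIMITS.  Composition of LANDED theorems over DISPLAYED rows on King's ∕ dag-n15-a's MODEL carriers; the GLOBAL small-field gauge only (no per-cube gauges — the flat
`∇^±` is not gauge-covariant); the FLAT jet (the covariant correction `M_a𝒢` of (3.42)'s `∇_U` is a bounded letter times entry 0 — not here); Bałaban's `P`, its law `P = N_L − N_V k` at
`w ≡ 1`, `N_V`'s letters and 48's rows are HYPOTHESES with located producers; nothing of [B5]∕[B6]∕[B9] asserted ((2.91)–(2.92), (2.133)–(2.136), (3.34)–(3.35), (3.42), (3.50)–(3.53),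
(3.62)–(3.65), Thm 3.14 = SHAPES ∕ MECHANISM ∕ TEMPLATE).  NE2⁺ NOT PRINTED, NOT proved; N15 NOT discharged; K3⁸ OPEN, skeleton v6 untouched (0∕2); counts of record UNMOVED (typed 28∕28 ·
discharged 5∕27 · A 5∕28); one finite 𝕋⁴ at fixed ε — NOT infinite volume, NOT OS on ℝ⁴, NOT a mass gap, NOT Clay; R4 closes the conditional finite-𝕋⁴ rung `BalabanLadder.UV` only.
Restate-immune (no Theses import).
-/

set_option autoImplicit false

noncomputable section
open scoped BigOperators Matrix Matrix.Norms.Frobenius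
open Finset

namespace Summit.QuantumFields.YangMills.BalabanUVNodes.N15.Gluing

open Literature.MathematicalPhysics.QuantumFieldTheory.Balaban1983to89
open Literature.MathematicalPhysics.QuantumFieldTheory.Balaban1983to89.B11SectG (BlockNorm HasMaj RowSum hasMaj_zero)
open Literature.MathematicalPhysics.QuantumFieldTheory.Balaban1983to89.B6RandomWalk (Triangle254)
open Literature.MathematicalPhysics.QuantumFieldTheory.Balaban1983to89.T4EtaRateDefect (idef idef_add)
open Literature.MathematicalPhysics.QuantumFieldTheory.Balaban1983to89.T4EtaRateCoeffDefect (pull)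
open Literature.MathematicalPhysics.QuantumFieldTheory.Balaban1983to89.B6Prop26Gluing (mulOp mulOp_apply ind ind_nonneg ind_le_one)
open Summit.QuantumFields.YangMills.BalabanUVNodes.N15.MatrixSpecies (mmulOp liftBlk liftMap liftEquiv liftEquiv_apply liftEquiv_symm_apply coordMat)
open Summit.QuantumFields.YangMills.BalabanUVNodes.N15.BackgroundLayer (fgrad bgrad fgradAdj stack projO blkPair liftPair bgPropV covLapM tCoefA tCoefC unstackM projO_none_comp_stack)
open Literature.Barriers.QuantumFields (traceForm)
open Summit.QuantumFields.YangMills.BalabanUVNodes.N15.CurvedSpecies (gaugePair uN_localOp_eq_cut_add_farDefect hasMaj_cutPert_structural_of_local hasMaj_idef_cutPert_structural_of_local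
  hasMaj_idef_of_eq_zero hasMaj_mulOp_farDefect_smoothCutDressed hasMaj_commOp_farDefect_structural hasMaj_idef_commOp_farDefect_structural hasMaj_idef_mulOp_farDefect_structural
  coordMat_conj_one mmulOp_one)

variable {X X' ι J K : Type} [Fintype X] [Fintype X'] [DecidableEq X] [DecidableEq X'] [Fintype ι] [DecidableEq ι] [Fintype J] [DecidableEq J] [Fintype K] {g : B6.Geometry}
  (blk : X → g.Site) (π : X' → X) (τ : J → X ≃ X) (τ' : J → X' ≃ X') {σ cr : ℝ}
  {N : K → (X × ι → ℝ) →ₗ[ℝ] (X × ι → ℝ)} {N' : K → (X' × ι → ℝ) →ₗ[ℝ] (X' × ι → ℝ)} {NL : (X × ι → ℝ) →ₗ[ℝ] (X × ι → ℝ)} {NL' : (X' × ι → ℝ) →ₗ[ℝ] (X' × ι → ℝ)}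
  {χX χtX ψX hX : K → X → ℝ} {χX' χtX' ψX' hX' : K → X' → ℝ} {Sk : K → Set g.Site} {hb : K → g.Site → ℝ}
  {β β₁ ct m₀ m₁ oχ oχ₁ oχ₂ δ : ℝ}

set_option maxHeartbeats 800000 in
/-- ★★★ **THE TWO-SPACING η-DEFECT OF EVERY FLAT JET COMPONENT OF THE GLUED PROPAGATORS OF BAŁABAN's COVARIANT OPERATORS `Δ_{R_U} + P` (coarse) AND `Δ′_{R_{U′}} + P′` (fine) FROM
DRESSED SMOOTH-CUT CUBES, IN THE GLOBAL GAUGE** (dag-n15-w3 53 at `u ≡ 1 ≡ u′` with `∇^±_j∘` in front): trace-form coordinates `e` of `𝔲(m)`, bond variables `U, U′`, the cube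
perturbations = the species `unstackM (tCoefC) (tCoefA)` of `1·U·1ᴴ` cut to the cube plus the cut nonlocal perturbations `N_V k`, `P`'s law at `w ≡ 1`, the (3.35) row letters where
`χ_k ≠ 0` and their fits, `N_V`'s letters∕far letters∕η-defects, 48's rows — for every jet index `j`: `𝔇_π(∇′_j∘𝒢′, ∇_j∘𝒢) ≤ K·e^{−(ρ₃−2σ)d}`, `K` = FILE 137a's kernel at 53's letters, written
out below.  The operands are LITERALLY the cover's `∇′_j ∘ cvGlued′ … 1 U′ P′ N′_V`, `∇_j ∘ cvGlued … 1 U P N_V` once instantiated.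
[cite: Balaban1985BackgroundPropagators, (3.34)–(3.35) p.396, (3.42) p.397 (gradient entries: shape), Thm 3.14 pp.426–427 (template), (3.50)–(3.53) p.400, (3.62)–(3.65) pp.402–403, (3.76)–(3.77) p.406 (mechanism); Balaban1984PropagatorsII, (2.91) p.239, (2.133)–(2.136) p.247] -/
theorem one_hasMaj_idef_jet_glueInv_smoothCutDressed {m : Type} [Fintype m] [DecidableEq m] (e : Matrix m m ℂ ≃L[ℝ] (ι → ℝ))
    {U : J → X → Matrix m m ℂ} {U' : J → X' → Matrix m m ℂ} {P : (X × ι → ℝ) →ₗ[ℝ] (X × ι → ℝ)} {P' : (X' × ι → ℝ) →ₗ[ℝ] (X' × ι → ℝ)} {NV : K → (X × ι → ℝ) →ₗ[ℝ] (X × ι → ℝ)}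
    {NV' : K → (X' × ι → ℝ) →ₗ[ℝ] (X' × ι → ℝ)} (η η' : ℝ) (htri : Triangle254 g) (hd : ∀ a b : g.Site, 0 ≤ g.dist a b) (hd0 : ∀ y : g.Site, g.dist y y = 0)
    (hsymm : ∀ y y', g.dist y y' = g.dist y' y) (hrow : RowSum g σ cr) (hσ : 0 ≤ σ) (hcr : 0 ≤ cr)
    {ρ₁ ρ₂ ρ₃ ρN ρT δV ε R o c₁ c₂ o₁ o₂ rW θW cN rN ℓ ω d₁ oo ε₀ rF Nov : ℝ} (hβ : 0 ≤ β) (hβ₁ : 0 ≤ β₁) (hct : 0 ≤ ct) (hm₀ : 0 ≤ m₀) (hm₁ : 0 ≤ m₁)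
    (hoχ : 0 ≤ oχ) (hoχ₁ : 0 ≤ oχ₁) (hoχ₂ : 0 ≤ oχ₂) (hR : 0 ≤ R) (ho : 0 ≤ o) (hσρ : σ ≤ ρ₁) (hρ₁V : ρ₁ ≤ δV) (hρ₁G : ρ₁ + σ ≤ δ) (hρ₂ : 0 ≤ ρ₂) (hρ₂₁ : ρ₂ + σ ≤ ρ₁)
    (hρ₂T : ρ₂ + σ ≤ ρT) (hρ₃ : 0 ≤ ρ₃) (hρ₃₂ : ρ₃ ≤ ρ₂) (hρ₃V : ρ₃ + σ ≤ δV - ε) (hρ₃N : ρ₃ + σ ≤ ρN) (hσρ₃ : 2 * σ ≤ ρ₃) (hε : 0 < ε) (hc₁ : 0 ≤ c₁) (hc₂ : 0 ≤ c₂)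
    (ho₁ : 0 ≤ o₁) (ho₂ : 0 ≤ o₂) (hrW : 0 ≤ rW) (hθW : 0 ≤ θW) (hcN : 0 ≤ cN) (hrN : 0 ≤ rN) (hℓ : 0 ≤ ℓ) (hω : 0 ≤ ω) (hd₁ : 0 ≤ d₁) (hoo : 0 ≤ oo) (hε₀ : 0 ≤ ε₀)
    (hrF : 0 ≤ rF) (hNov : 0 ≤ Nov) (hn : 0 < η⁻¹) (hn' : 0 < η'⁻¹)
    (hSχ : ∀ k, ∀ x, (χX k) x ≠ 0 → blk x ∈ (Sk k)) (hSψ : ∀ k, ∀ x, (ψX k) x ≠ 0 → blk x ∈ (Sk k)) (hSχ' : ∀ k, ∀ x', (χX' k) x' ≠ 0 → blk (π x') ∈ (Sk k)) (hSψ' : ∀ k, ∀ x', (ψX' k) x' ≠ 0 → blk (π x') ∈ (Sk k))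
    -- coarse bump data
    (hχt : ∀ k, ∀ x, |(χtX k) x| ≤ 1)
    (hdχt : ∀ k, ∀ μ p, |fgrad η⁻¹ (liftEquiv (τ μ) ι) (fun p : X × ι => (χtX k) p.1) p| ≤ ct) (hdχtb : ∀ k, ∀ μ p, |bgrad η⁻¹ (liftEquiv (τ μ) ι) (fun p : X × ι => (χtX k) p.1) p| ≤ ct)
    (hsub : ∀ k, mulOp (fun p : X × ι => (χtX k) p.1) ∘ₗ mulOp (fun p : X × ι => (χX k) p.1) = mulOp (fun p : X × ι => (χtX k) p.1))
    (hχ : ∀ k, mulOp (fun p : X × ι => (χX k) p.1) ∘ₗ mulOp (fun p : X × ι => (χtX k) p.1) = mulOp (fun p : X × ι => (χtX k) p.1))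
    (hs : ∀ k, ∀ μ, mulOp ((fun p : X × ι => (χtX k) p.1) ∘ (liftEquiv (τ μ) ι)) ∘ₗ mulOp (fun p : X × ι => (χX k) p.1) = mulOp ((fun p : X × ι => (χtX k) p.1) ∘ (liftEquiv (τ μ) ι)))
    (hsb : ∀ k, ∀ μ, mulOp ((fun p : X × ι => (χtX k) p.1) ∘ (liftEquiv (τ μ) ι).symm) ∘ₗ mulOp (fun p : X × ι => (χX k) p.1) = mulOp ((fun p : X × ι => (χtX k) p.1) ∘ (liftEquiv (τ μ) ι).symm))
    (hdd : ∀ k, ∀ μ, mulOp (fgrad η⁻¹ (liftEquiv (τ μ) ι) (fun p : X × ι => (χtX k) p.1)) ∘ₗ mulOp (fun p : X × ι => (χX k) p.1) = mulOp (fgrad η⁻¹ (liftEquiv (τ μ) ι) (fun p : X × ι => (χtX k) p.1)))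
    (hddb : ∀ k, ∀ μ, mulOp (bgrad η⁻¹ (liftEquiv (τ μ) ι) (fun p : X × ι => (χtX k) p.1)) ∘ₗ mulOp (fun p : X × ι => (χX k) p.1) = mulOp (bgrad η⁻¹ (liftEquiv (τ μ) ι) (fun p : X × ι => (χtX k) p.1)))
    (hNψ : ∀ k, (N k) ∘ₗ mulOp (fun p : X × ι => (ψX k) p.1) = (N k))
    -- fine bump data
    (hχt' : ∀ k, ∀ x', |(χtX' k) x'| ≤ 1)
    (hdχt' : ∀ k, ∀ μ p', |fgrad η'⁻¹ (liftEquiv (τ' μ) ι) (fun p' : X' × ι => (χtX' k) p'.1) p'| ≤ ct) (hdχtb' : ∀ k, ∀ μ p', |bgrad η'⁻¹ (liftEquiv (τ' μ) ι) (fun p' : X' × ι => (χtX' k) p'.1) p'| ≤ ct)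
    (hsub' : ∀ k, mulOp (fun p : X' × ι => (χtX' k) p.1) ∘ₗ mulOp (fun p : X' × ι => (χX' k) p.1) = mulOp (fun p : X' × ι => (χtX' k) p.1))
    (hχ' : ∀ k, mulOp (fun p : X' × ι => (χX' k) p.1) ∘ₗ mulOp (fun p : X' × ι => (χtX' k) p.1) = mulOp (fun p : X' × ι => (χtX' k) p.1))
    (hs' : ∀ k, ∀ μ, mulOp ((fun p' : X' × ι => (χtX' k) p'.1) ∘ (liftEquiv (τ' μ) ι)) ∘ₗ mulOp (fun p' : X' × ι => (χX' k) p'.1) = mulOp ((fun p' : X' × ι => (χtX' k) p'.1) ∘ (liftEquiv (τ' μ) ι)))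
    (hsb' : ∀ k, ∀ μ, mulOp ((fun p' : X' × ι => (χtX' k) p'.1) ∘ (liftEquiv (τ' μ) ι).symm) ∘ₗ mulOp (fun p' : X' × ι => (χX' k) p'.1) =
      mulOp ((fun p' : X' × ι => (χtX' k) p'.1) ∘ (liftEquiv (τ' μ) ι).symm))
    (hdd' : ∀ k, ∀ μ, mulOp (fgrad η'⁻¹ (liftEquiv (τ' μ) ι) (fun p' : X' × ι => (χtX' k) p'.1)) ∘ₗ mulOp (fun p' : X' × ι => (χX' k) p'.1) = mulOp (fgrad η'⁻¹ (liftEquiv (τ' μ) ι) (fun p' : X' × ι => (χtX' k) p'.1)))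
    (hddb' : ∀ k, ∀ μ, mulOp (bgrad η'⁻¹ (liftEquiv (τ' μ) ι) (fun p' : X' × ι => (χtX' k) p'.1)) ∘ₗ mulOp (fun p' : X' × ι => (χX' k) p'.1) = mulOp (bgrad η'⁻¹ (liftEquiv (τ' μ) ι) (fun p' : X' × ι => (χtX' k) p'.1)))
    (hNψ' : ∀ k, (N' k) ∘ₗ mulOp (fun p : X' × ι => (ψX' k) p.1) = (N' k))
    -- fits of the bumps across `π`
    (hfitχ : ∀ k, ∀ x', |(χtX' k) x' - (χtX k) (π x')| ≤ oχ)
    (hfit₁ : ∀ k, ∀ μ p', |((fun p' : X' × ι => (χtX' k) p'.1) ∘ (liftEquiv (τ' μ) ι)) p' - ((fun p : X × ι => (χtX k) p.1) ∘ (liftEquiv (τ μ) ι)) (liftMap π ι p')| ≤ oχ₁)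
    (hfit₁b : ∀ k, ∀ μ p', |((fun p' : X' × ι => (χtX' k) p'.1) ∘ (liftEquiv (τ' μ) ι).symm) p' - ((fun p : X × ι => (χtX k) p.1) ∘ (liftEquiv (τ μ) ι).symm) (liftMap π ι p')| ≤ oχ₁)
    (hfit₂ : ∀ k, ∀ μ p', |fgrad η'⁻¹ (liftEquiv (τ' μ) ι) (fun p' : X' × ι => (χtX' k) p'.1) p' - fgrad η⁻¹ (liftEquiv (τ μ) ι) (fun p : X × ι => (χtX k) p.1) (liftMap π ι p')| ≤ oχ₂)
    (hfit₂b : ∀ k, ∀ μ p', |bgrad η'⁻¹ (liftEquiv (τ' μ) ι) (fun p' : X' × ι => (χtX' k) p'.1) p' - bgrad η⁻¹ (liftEquiv (τ μ) ι) (fun p : X × ι => (χtX k) p.1) (liftMap π ι p')| ≤ oχ₂)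
    -- cut rows and their defects
    (hcut : ∀ k, HasMaj (BlockNorm.ofBlocks g (liftBlk blk ι)) (BlockNorm.ofBlocks g (liftBlk blk ι)) (mulOp (fun p : X × ι => (χX k) p.1) ∘ₗ (N k))
      (fun y y' => ind (Sk k) y * ind (Sk k) y' * (β * Real.exp (-(δ * g.dist y y')))))
    (hcutF : ∀ k, ∀ μ, HasMaj (BlockNorm.ofBlocks g (liftBlk blk ι)) (BlockNorm.ofBlocks g (liftBlk blk ι)) (mulOp (fun p : X × ι => (χX k) p.1) ∘ₗ (fgrad η⁻¹ (liftEquiv (τ μ) ι) ∘ₗ (N k)))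
      (fun y y' => ind (Sk k) y * ind (Sk k) y' * (β₁ * Real.exp (-(δ * g.dist y y')))))
    (hcutB : ∀ k, ∀ μ, HasMaj (BlockNorm.ofBlocks g (liftBlk blk ι)) (BlockNorm.ofBlocks g (liftBlk blk ι)) (mulOp (fun p : X × ι => (χX k) p.1) ∘ₗ (bgrad η⁻¹ (liftEquiv (τ μ) ι) ∘ₗ (N k)))
      (fun y y' => ind (Sk k) y * ind (Sk k) y' * (β₁ * Real.exp (-(δ * g.dist y y')))))
    (hcut' : ∀ k, HasMaj (BlockNorm.ofBlocks g (liftBlk (blk ∘ π) ι)) (BlockNorm.ofBlocks g (liftBlk (blk ∘ π) ι)) (mulOp (fun p : X' × ι => (χX' k) p.1) ∘ₗ (N' k))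
      (fun y y' => ind (Sk k) y * ind (Sk k) y' * (β * Real.exp (-(δ * g.dist y y')))))
    (hcutF' : ∀ k, ∀ μ, HasMaj (BlockNorm.ofBlocks g (liftBlk (blk ∘ π) ι)) (BlockNorm.ofBlocks g (liftBlk (blk ∘ π) ι)) (mulOp (fun p : X' × ι => (χX' k) p.1) ∘ₗ (fgrad η'⁻¹ (liftEquiv (τ' μ) ι) ∘ₗ (N' k)))
      (fun y y' => ind (Sk k) y * ind (Sk k) y' * (β₁ * Real.exp (-(δ * g.dist y y')))))
    (hcutB' : ∀ k, ∀ μ, HasMaj (BlockNorm.ofBlocks g (liftBlk (blk ∘ π) ι)) (BlockNorm.ofBlocks g (liftBlk (blk ∘ π) ι)) (mulOp (fun p : X' × ι => (χX' k) p.1) ∘ₗ (bgrad η'⁻¹ (liftEquiv (τ' μ) ι) ∘ₗ (N' k)))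
      (fun y y' => ind (Sk k) y * ind (Sk k) y' * (β₁ * Real.exp (-(δ * g.dist y y')))))
    (hDcut : ∀ k, HasMaj (BlockNorm.ofBlocks g (liftBlk blk ι)) (BlockNorm.ofBlocks g (liftBlk blk ι ∘ liftMap π ι))
      (idef (pull (liftMap π ι)) (pull (liftMap π ι)) (mulOp (fun p : X' × ι => (χX' k) p.1) ∘ₗ (N' k)) (mulOp (fun p : X × ι => (χX k) p.1) ∘ₗ (N k)))
      (fun y y' => ind (Sk k) y * ind (Sk k) y' * (m₀ * Real.exp (-(δ * g.dist y y')))))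
    (hDcutF : ∀ k, ∀ μ, HasMaj (BlockNorm.ofBlocks g (liftBlk blk ι)) (BlockNorm.ofBlocks g (liftBlk blk ι ∘ liftMap π ι))
      (idef (pull (liftMap π ι)) (pull (liftMap π ι)) (mulOp (fun p : X' × ι => (χX' k) p.1) ∘ₗ (fgrad η'⁻¹ (liftEquiv (τ' μ) ι) ∘ₗ (N' k))) (mulOp (fun p : X × ι => (χX k) p.1) ∘ₗ (fgrad η⁻¹ (liftEquiv (τ μ) ι) ∘ₗ (N k))))
      (fun y y' => ind (Sk k) y * ind (Sk k) y' * (m₁ * Real.exp (-(δ * g.dist y y')))))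
    (hDcutB : ∀ k, ∀ μ, HasMaj (BlockNorm.ofBlocks g (liftBlk blk ι)) (BlockNorm.ofBlocks g (liftBlk blk ι ∘ liftMap π ι))
      (idef (pull (liftMap π ι)) (pull (liftMap π ι)) (mulOp (fun p : X' × ι => (χX' k) p.1) ∘ₗ (bgrad η'⁻¹ (liftEquiv (τ' μ) ι) ∘ₗ (N' k))) (mulOp (fun p : X × ι => (χX k) p.1) ∘ₗ (bgrad η⁻¹ (liftEquiv (τ μ) ι) ∘ₗ (N k))))
      (fun y y' => ind (Sk k) y * ind (Sk k) y' * (m₁ * Real.exp (-(δ * g.dist y y')))))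
    -- the jet pieces' reversed insertions (output cut-offs), both grids
    (hs2 : ∀ k, ∀ μ, mulOp (fun p : X × ι => (χX k) p.1) ∘ₗ mulOp ((fun p : X × ι => (χtX k) p.1) ∘ (liftEquiv (τ μ) ι)) = mulOp ((fun p : X × ι => (χtX k) p.1) ∘ (liftEquiv (τ μ) ι)))
    (hsb2 : ∀ k, ∀ μ, mulOp (fun p : X × ι => (χX k) p.1) ∘ₗ mulOp ((fun p : X × ι => (χtX k) p.1) ∘ (liftEquiv (τ μ) ι).symm) = mulOp ((fun p : X × ι => (χtX k) p.1) ∘ (liftEquiv (τ μ) ι).symm))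
    (hdd2 : ∀ k, ∀ μ, mulOp (fun p : X × ι => (χX k) p.1) ∘ₗ mulOp (fgrad η⁻¹ (liftEquiv (τ μ) ι) (fun p : X × ι => (χtX k) p.1)) = mulOp (fgrad η⁻¹ (liftEquiv (τ μ) ι) (fun p : X × ι => (χtX k) p.1)))
    (hddb2 : ∀ k, ∀ μ, mulOp (fun p : X × ι => (χX k) p.1) ∘ₗ mulOp (bgrad η⁻¹ (liftEquiv (τ μ) ι) (fun p : X × ι => (χtX k) p.1)) = mulOp (bgrad η⁻¹ (liftEquiv (τ μ) ι) (fun p : X × ι => (χtX k) p.1)))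
    (hs2' : ∀ k, ∀ μ, mulOp (fun p' : X' × ι => (χX' k) p'.1) ∘ₗ mulOp ((fun p' : X' × ι => (χtX' k) p'.1) ∘ (liftEquiv (τ' μ) ι)) = mulOp ((fun p' : X' × ι => (χtX' k) p'.1) ∘ (liftEquiv (τ' μ) ι)))
    (hsb2' : ∀ k, ∀ μ, mulOp (fun p' : X' × ι => (χX' k) p'.1) ∘ₗ mulOp ((fun p' : X' × ι => (χtX' k) p'.1) ∘ (liftEquiv (τ' μ) ι).symm) =
      mulOp ((fun p' : X' × ι => (χtX' k) p'.1) ∘ (liftEquiv (τ' μ) ι).symm))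
    (hdd2' : ∀ k, ∀ μ, mulOp (fun p' : X' × ι => (χX' k) p'.1) ∘ₗ mulOp (fgrad η'⁻¹ (liftEquiv (τ' μ) ι) (fun p' : X' × ι => (χtX' k) p'.1)) = mulOp (fgrad η'⁻¹ (liftEquiv (τ' μ) ι) (fun p' : X' × ι => (χtX' k) p'.1)))
    (hddb2' : ∀ k, ∀ μ, mulOp (fun p' : X' × ι => (χX' k) p'.1) ∘ₗ mulOp (bgrad η'⁻¹ (liftEquiv (τ' μ) ι) (fun p' : X' × ι => (χtX' k) p'.1)) = mulOp (bgrad η'⁻¹ (liftEquiv (τ' μ) ι) (fun p' : X' × ι => (χtX' k) p'.1)))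
    (hq : (β + (β₁ + ct * β)) * (R * cr) * cr < 1)
    (hh1 : ∀ k, ∀ μ p, |fgrad η⁻¹ (liftEquiv (τ μ) ι) (fun p : X × ι => hX k p.1) p| ≤ c₁) (hh1b : ∀ k, ∀ μ p, |bgrad η⁻¹ (liftEquiv (τ μ) ι) (fun p : X × ι => hX k p.1) p| ≤ c₁)
    (hh1' : ∀ k, ∀ μ p', |fgrad η'⁻¹ (liftEquiv (τ' μ) ι) (fun p : X' × ι => hX' k p.1) p'| ≤ c₁) (hh1b' : ∀ k, ∀ μ p', |bgrad η'⁻¹ (liftEquiv (τ' μ) ι) (fun p : X' × ι => hX' k p.1) p'| ≤ c₁)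
    (hh2' : ∀ k, ∀ μ p', |fgradAdj η'⁻¹ (liftEquiv (τ' μ) ι) (fgrad η'⁻¹ (liftEquiv (τ' μ) ι) (fun p : X' × ι => hX' k p.1)) p'| ≤ c₂)
    (hf1 : ∀ k, ∀ μ p', |fgrad η'⁻¹ (liftEquiv (τ' μ) ι) (fun p : X' × ι => hX' k p.1) p' - fgrad η⁻¹ (liftEquiv (τ μ) ι) (fun p : X × ι => hX k p.1) (liftMap π ι p')| ≤ o₁)
    (hf1b : ∀ k, ∀ μ p', |bgrad η'⁻¹ (liftEquiv (τ' μ) ι) (fun p : X' × ι => hX' k p.1) p' - bgrad η⁻¹ (liftEquiv (τ μ) ι) (fun p : X × ι => hX k p.1) (liftMap π ι p')| ≤ o₁)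
    (hf2 : ∀ k, ∀ μ p', |fgradAdj η'⁻¹ (liftEquiv (τ' μ) ι) (fgrad η'⁻¹ (liftEquiv (τ' μ) ι) (fun p : X' × ι => hX' k p.1)) p' - fgradAdj η⁻¹ (liftEquiv (τ μ) ι) (fgrad η⁻¹ (liftEquiv (τ μ) ι) (fun p : X × ι => hX k p.1)) (liftMap π ι p')| ≤ o₂)
    (hLip : ∀ k, ∀ y y', |(hb k) y - (hb k) y'| ≤ ℓ * g.dist y y') (hrh : ∀ k (p : X × ι), |hX k p.1 - (hb k) (liftBlk blk ι p)| ≤ ω) (hrh' : ∀ k (p' : X' × ι), |hX' k p'.1 - (hb k) (liftBlk (blk ∘ π) ι p')| ≤ ω)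
    (hfh : ∀ k (p' : X' × ι), |hX' k p'.1 - hX k (π p'.1)| ≤ oo) (hstep : ∀ μ x, g.dist (blk (τ μ x)) (blk x) ≤ d₁) (hstep' : ∀ μ x', g.dist (blk (π (τ' μ x'))) (blk (π x')) ≤ d₁)
    (hKN' : ∀ k, HasMaj (BlockNorm.ofBlocks g (liftBlk (blk ∘ π) ι)) (BlockNorm.ofBlocks g (liftBlk (blk ∘ π) ι)) (commOp NL' (fun p : X' × ι => hX' k p.1)) (fun y y' => cN * Real.exp (-(ρN * g.dist y y'))))
    (hDKN : ∀ k, HasMaj (BlockNorm.ofBlocks g (liftBlk blk ι)) (BlockNorm.ofBlocks g (liftBlk (blk ∘ π) ι))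
      (idef (pull (liftMap π ι)) (pull (liftMap π ι)) (commOp NL' (fun p : X' × ι => hX' k p.1)) (commOp NL (fun p : X × ι => hX k p.1))) (fun y y' => rN * Real.exp (-(ρN * g.dist y y'))))

    -- per cube, beyond file 39's data: the coarse second differences, the one-grid `W`-rows at both grids, the coarse `[N_L, M_h]` letter, the partition's sizes and cut support, the tail rows and their defect
    (hh2 : ∀ k, ∀ μ p, |fgradAdj η⁻¹ (liftEquiv (τ μ) ι) (fgrad η⁻¹ (liftEquiv (τ μ) ι) (fun p : X × ι => hX k p.1)) p| ≤ c₂)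
    (hKN : ∀ k, HasMaj (BlockNorm.ofBlocks g (liftBlk blk ι)) (BlockNorm.ofBlocks g (liftBlk blk ι)) (commOp NL (fun p : X × ι => hX k p.1)) (fun y y' => cN * Real.exp (-(ρN * g.dist y y'))))
    (hhabs : ∀ k x, |hX k x| ≤ 1) (hhabs' : ∀ k x', |hX' k x'| ≤ 1)
    (hhcut : ∀ k, mulOp (fun p : X × ι => hX k p.1) ∘ₗ mulOp (fun p : X × ι => χX k p.1) = mulOp (fun p : X × ι => hX k p.1)) (hhcut' : ∀ k, mulOp (fun p : X' × ι => hX' k p.1) ∘ₗ mulOp (fun p : X' × ι => χX' k p.1) = mulOp (fun p : X' × ι => hX' k p.1))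
    (hN : ∀ b, ∑ k, ind (Sk k) b ≤ Nov)
    (hT : ∀ k, HasMaj (BlockNorm.ofBlocks g (liftBlk blk ι)) (BlockNorm.ofBlocks g (liftBlk blk ι)) ((-(mulOp (fun p : X × ι => hX k p.1) ∘ₗ NL ∘ₗ mulOp (1 - fun p : X × ι => χtX k p.1))) ∘ₗ N k) (fun y y' => ind (Sk k) y * ind (Sk k) y' * (ε₀ * Real.exp (-(ρT * g.dist y y')))))
    (hT' : ∀ k, HasMaj (BlockNorm.ofBlocks g (liftBlk (blk ∘ π) ι)) (BlockNorm.ofBlocks g (liftBlk (blk ∘ π) ι)) ((-(mulOp (fun p : X' × ι => hX' k p.1) ∘ₗ NL' ∘ₗ mulOp (1 - fun p : X' × ι => χtX' k p.1))) ∘ₗ N' k) (fun y y' => ind (Sk k) y * ind (Sk k) y' * (ε₀ * Real.exp (-(ρT * g.dist y y')))))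
    (hDT : ∀ k, HasMaj (BlockNorm.ofBlocks g (liftBlk blk ι)) (BlockNorm.ofBlocks g (liftBlk (blk ∘ π) ι)) (idef (pull (liftMap π ι)) (pull (liftMap π ι)) ((-(mulOp (fun p : X' × ι => hX' k p.1) ∘ₗ NL' ∘ₗ mulOp (1 - fun p : X' × ι => χtX' k p.1))) ∘ₗ N' k) ((-(mulOp (fun p : X × ι => hX k p.1) ∘ₗ NL ∘ₗ mulOp (1 - fun p : X × ι => χtX k p.1))) ∘ₗ N k)) (fun y y' => ind (Sk k) y * ind (Sk k) y' * (rF * Real.exp (-(ρT * g.dist y y')))))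
    -- THE GLOBAL GAUGE ON BOTH GRIDS (`u ≡ 1 ≡ u′`): trace-form coordinates `e` of `𝔤 = 𝔲(m)`, bond variables `U`, `U′`,
    -- Bałaban's nonlocal summands `P`, `P′` read in the cube's gauges as the flat `N_L`, `N′_L` minus per-cube nonlocal perturbations `N_V k`, `N′_V k`; the species of the transformed bond
    -- variables SMALL WHERE `χ_k ≠ 0` ∕ `χ′_k ≠ 0` ((3.35) on the cube) and FITTING across `π` on the cut; the letters, far letters and η-defects of `N_V k`, `N′_V k`
    (he : ∀ A B : Matrix m m ℂ, traceForm A B = e A ⬝ᵥ e B) {rV RN θF ρF rD oV oN : ℝ} (hrV : 0 ≤ rV)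
    (hRN : 0 ≤ RN) (hθF : 0 ≤ θF) (hρF : ρ₃ + σ ≤ ρF) (hrD : 0 ≤ rD) (hoV : 0 ≤ oV) (hoN : 0 ≤ oN) (hRle : rV * (1 + Fintype.card (J ⊕ J)) + RN ≤ R) (hole : oV * (1 + Fintype.card (J ⊕ J)) + oN ≤ o)
    (hP : ∀ k, mmulOp (fun _ => coordMat e (ContinuousLinearMap.mulLeftRight ℝ (Matrix m m ℂ) (1 : Matrix m m ℂ) (1 : Matrix m m ℂ)ᴴ)) ∘ₗ P ∘ₗ mmulOp (fun _ => (coordMat e (ContinuousLinearMap.mulLeftRight ℝ (Matrix m m ℂ) (1 : Matrix m m ℂ) (1 : Matrix m m ℂ)ᴴ))ᵀ) = NL - NV k)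
    (hP' : ∀ k, mmulOp (fun _ => coordMat e (ContinuousLinearMap.mulLeftRight ℝ (Matrix m m ℂ) (1 : Matrix m m ℂ) (1 : Matrix m m ℂ)ᴴ)) ∘ₗ P' ∘ₗ mmulOp (fun _ => (coordMat e (ContinuousLinearMap.mulLeftRight ℝ (Matrix m m ℂ) (1 : Matrix m m ℂ) (1 : Matrix m m ℂ)ᴴ))ᵀ) = NL' - NV' k)
    (hχ1 : ∀ k x, |χX k x| ≤ 1) (hχ1' : ∀ k x', |χX' k x'| ≤ 1) (hψχ : ∀ k, mulOp (fun p : X × ι => ψX k p.1) ∘ₗ mulOp (fun p : X × ι => χX k p.1) = mulOp (fun p : X × ι => χX k p.1))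
    (hψχ' : ∀ k, mulOp (fun p : X' × ι => ψX' k p.1) ∘ₗ mulOp (fun p : X' × ι => χX' k p.1) = mulOp (fun p : X' × ι => χX' k p.1))
    (hCloc : ∀ k x, χX k x ≠ 0 → ∀ i, ∑ j, |tCoefC η (gaugePair τ fun μ x => coordMat e (ContinuousLinearMap.mulLeftRight ℝ (Matrix m m ℂ) ((1 : Matrix m m ℂ) * U μ x * (1 : Matrix m m ℂ)ᴴ) ((1 : Matrix m m ℂ) * U μ x * (1 : Matrix m m ℂ)ᴴ)ᴴ)) x i j| ≤ rV)
    (hAloc : ∀ k j' x, χX k x ≠ 0 → ∀ i, ∑ j, |tCoefA η (gaugePair τ fun μ x => coordMat e (ContinuousLinearMap.mulLeftRight ℝ (Matrix m m ℂ) ((1 : Matrix m m ℂ) * U μ x * (1 : Matrix m m ℂ)ᴴ) ((1 : Matrix m m ℂ) * U μ x * (1 : Matrix m m ℂ)ᴴ)ᴴ)) j' x i j| ≤ rV)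
    (hCloc' : ∀ k x', χX' k x' ≠ 0 → ∀ i, ∑ j, |tCoefC η' (gaugePair τ' fun μ x' => coordMat e (ContinuousLinearMap.mulLeftRight ℝ (Matrix m m ℂ) ((1 : Matrix m m ℂ) * U' μ x' * (1 : Matrix m m ℂ)ᴴ) ((1 : Matrix m m ℂ) * U' μ x' * (1 : Matrix m m ℂ)ᴴ)ᴴ)) x' i j| ≤ rV)
    (hAloc' : ∀ k j' x', χX' k x' ≠ 0 → ∀ i, ∑ j, |tCoefA η' (gaugePair τ' fun μ x' => coordMat e (ContinuousLinearMap.mulLeftRight ℝ (Matrix m m ℂ) ((1 : Matrix m m ℂ) * U' μ x' * (1 : Matrix m m ℂ)ᴴ) ((1 : Matrix m m ℂ) * U' μ x' * (1 : Matrix m m ℂ)ᴴ)ᴴ)) j' x' i j| ≤ rV)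
    (hfitC : ∀ k x' i, ∑ j, |(χX' k x' • tCoefC η' (gaugePair τ' fun μ x' => coordMat e (ContinuousLinearMap.mulLeftRight ℝ (Matrix m m ℂ) ((1 : Matrix m m ℂ) * U' μ x' * (1 : Matrix m m ℂ)ᴴ) ((1 : Matrix m m ℂ) * U' μ x' * (1 : Matrix m m ℂ)ᴴ)ᴴ)) x') i j - (χX k (π x') • tCoefC η (gaugePair τ fun μ x => coordMat e (ContinuousLinearMap.mulLeftRight ℝ (Matrix m m ℂ) ((1 : Matrix m m ℂ) * U μ x * (1 : Matrix m m ℂ)ᴴ) ((1 : Matrix m m ℂ) * U μ x * (1 : Matrix m m ℂ)ᴴ)ᴴ)) (π x')) i j| ≤ oV)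
    (hfitA : ∀ k j' x' i, ∑ j, |(χX' k x' • tCoefA η' (gaugePair τ' fun μ x' => coordMat e (ContinuousLinearMap.mulLeftRight ℝ (Matrix m m ℂ) ((1 : Matrix m m ℂ) * U' μ x' * (1 : Matrix m m ℂ)ᴴ) ((1 : Matrix m m ℂ) * U' μ x' * (1 : Matrix m m ℂ)ᴴ)ᴴ)) j' x') i j - (χX k (π x') • tCoefA η (gaugePair τ fun μ x => coordMat e (ContinuousLinearMap.mulLeftRight ℝ (Matrix m m ℂ) ((1 : Matrix m m ℂ) * U μ x * (1 : Matrix m m ℂ)ᴴ) ((1 : Matrix m m ℂ) * U μ x * (1 : Matrix m m ℂ)ᴴ)ᴴ)) j' (π x')) i j| ≤ oV)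
    (hNVcut : ∀ k, HasMaj (BlockNorm.ofBlocks g (liftBlk blk ι)) (BlockNorm.ofBlocks g (liftBlk blk ι)) (mulOp (fun p : X × ι => ψX k p.1) ∘ₗ NV k ∘ₗ mulOp (fun p : X × ι => χX k p.1)) (fun y y' => RN * Real.exp (-(δV * g.dist y y'))))
    (hNVcut' : ∀ k, HasMaj (BlockNorm.ofBlocks g (liftBlk (blk ∘ π) ι)) (BlockNorm.ofBlocks g (liftBlk (blk ∘ π) ι)) (mulOp (fun p : X' × ι => ψX' k p.1) ∘ₗ NV' k ∘ₗ mulOp (fun p : X' × ι => χX' k p.1)) (fun y y' => RN * Real.exp (-(δV * g.dist y y'))))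
    (hDNV : ∀ k, HasMaj (BlockNorm.ofBlocks g (liftBlk blk ι)) (BlockNorm.ofBlocks g (liftBlk (blk ∘ π) ι))
      (idef (pull (liftMap π ι)) (pull (liftMap π ι)) (mulOp (fun p : X' × ι => ψX' k p.1) ∘ₗ NV' k ∘ₗ mulOp (fun p : X' × ι => χX' k p.1)) (mulOp (fun p : X × ι => ψX k p.1) ∘ₗ NV k ∘ₗ mulOp (fun p : X × ι => χX k p.1))) (fun y y' => oN * Real.exp (-(δV * g.dist y y'))))
    (hfarN : ∀ k, HasMaj (BlockNorm.ofBlocks g (liftBlk blk ι)) (BlockNorm.ofBlocks g (liftBlk blk ι)) ((LinearMap.id - mulOp (fun p : X × ι => ψX k p.1)) ∘ₗ NV k ∘ₗ mulOp (fun p : X × ι => χX k p.1)) (fun y y' => θF * Real.exp (-(ρF * g.dist y y'))))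
    (hfarN' : ∀ k, HasMaj (BlockNorm.ofBlocks g (liftBlk (blk ∘ π) ι)) (BlockNorm.ofBlocks g (liftBlk (blk ∘ π) ι)) ((LinearMap.id - mulOp (fun p : X' × ι => ψX' k p.1)) ∘ₗ NV' k ∘ₗ mulOp (fun p : X' × ι => χX' k p.1)) (fun y y' => θF * Real.exp (-(ρF * g.dist y y'))))
    (hDfarN : ∀ k, HasMaj (BlockNorm.ofBlocks g (liftBlk blk ι)) (BlockNorm.ofBlocks g (liftBlk (blk ∘ π) ι)) (idef (pull (liftMap π ι)) (pull (liftMap π ι)) ((LinearMap.id - mulOp (fun p : X' × ι => ψX' k p.1)) ∘ₗ NV' k ∘ₗ mulOp (fun p : X' × ι => χX' k p.1))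
      ((LinearMap.id - mulOp (fun p : X × ι => ψX k p.1)) ∘ₗ NV k ∘ₗ mulOp (fun p : X × ι => χX k p.1))) (fun y y' => rD * Real.exp (-(ρF * g.dist y y'))))
    -- supports of the partitions inside `ψ_k`, `χ_k` ∕ `ψ′_k`, `χ′_k` (with shifts and differences), both grids
    (hhψ : ∀ k, mulOp (fun p : X × ι => hX k p.1) ∘ₗ mulOp (fun p : X × ι => ψX k p.1) = mulOp (fun p : X × ι => hX k p.1)) (hχh : ∀ k, mulOp (fun p : X × ι => χX k p.1) ∘ₗ mulOp (fun p : X × ι => hX k p.1) = mulOp (fun p : X × ι => hX k p.1))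
    (hhs' : ∀ k μ, mulOp (fun p : X × ι => χX k p.1) ∘ₗ mulOp ((fun p : X × ι => hX k p.1) ∘ (liftEquiv (τ μ) ι)) = mulOp ((fun p : X × ι => hX k p.1) ∘ (liftEquiv (τ μ) ι)))
    (hhsb' : ∀ k μ, mulOp (fun p : X × ι => χX k p.1) ∘ₗ mulOp ((fun p : X × ι => hX k p.1) ∘ (liftEquiv (τ μ) ι).symm) = mulOp ((fun p : X × ι => hX k p.1) ∘ (liftEquiv (τ μ) ι).symm))
    (hhdd' : ∀ k μ, mulOp (fun p : X × ι => χX k p.1) ∘ₗ mulOp (fgrad η⁻¹ (liftEquiv (τ μ) ι) (fun p : X × ι => hX k p.1)) = mulOp (fgrad η⁻¹ (liftEquiv (τ μ) ι) (fun p : X × ι => hX k p.1)))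
    (hhddb' : ∀ k μ, mulOp (fun p : X × ι => χX k p.1) ∘ₗ mulOp (bgrad η⁻¹ (liftEquiv (τ μ) ι) (fun p : X × ι => hX k p.1)) = mulOp (bgrad η⁻¹ (liftEquiv (τ μ) ι) (fun p : X × ι => hX k p.1)))
    (hhψf : ∀ k, mulOp (fun p : X' × ι => hX' k p.1) ∘ₗ mulOp (fun p : X' × ι => ψX' k p.1) = mulOp (fun p : X' × ι => hX' k p.1)) (hχhf : ∀ k, mulOp (fun p : X' × ι => χX' k p.1) ∘ₗ mulOp (fun p : X' × ι => hX' k p.1) = mulOp (fun p : X' × ι => hX' k p.1))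
    (hhsf : ∀ k μ, mulOp (fun p : X' × ι => χX' k p.1) ∘ₗ mulOp ((fun p : X' × ι => hX' k p.1) ∘ (liftEquiv (τ' μ) ι)) = mulOp ((fun p : X' × ι => hX' k p.1) ∘ (liftEquiv (τ' μ) ι)))
    (hhsbf : ∀ k μ, mulOp (fun p : X' × ι => χX' k p.1) ∘ₗ mulOp ((fun p : X' × ι => hX' k p.1) ∘ (liftEquiv (τ' μ) ι).symm) = mulOp ((fun p : X' × ι => hX' k p.1) ∘ (liftEquiv (τ' μ) ι).symm))
    (hhddf : ∀ k μ, mulOp (fun p : X' × ι => χX' k p.1) ∘ₗ mulOp (fgrad η'⁻¹ (liftEquiv (τ' μ) ι) (fun p : X' × ι => hX' k p.1)) = mulOp (fgrad η'⁻¹ (liftEquiv (τ' μ) ι) (fun p : X' × ι => hX' k p.1)))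
    (hhddbf : ∀ k μ, mulOp (fun p : X' × ι => χX' k p.1) ∘ₗ mulOp (bgrad η'⁻¹ (liftEquiv (τ' μ) ι) (fun p : X' × ι => hX' k p.1)) = mulOp (bgrad η'⁻¹ (liftEquiv (τ' μ) ι) (fun p : X' × ι => hX' k p.1)))
    (hq' : Nov * (((((Fintype.card J : ℝ) * (c₂ * ((β + (β₁ + ct * β)) * (1 - (β + (β₁ + ct * β)) * (R * cr) * cr)⁻¹) + 2 * (c₁ * ((β + (β₁ + ct * β)) * (1 - (β + (β₁ + ct * β)) * (R * cr) * cr)⁻¹))) + θW + cN * ((β + (β₁ + ct * β)) * (1 - (β + (β₁ + ct * β)) * (R * cr) * cr)⁻¹) * cr)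
          + ((ℓ * (Real.exp 1 * ε)⁻¹ + 2 * (ω + ℓ * d₁)) * R * ((β + (β₁ + ct * β)) * (1 - (β + (β₁ + ct * β)) * (R * cr) * cr)⁻¹) * cr + R * c₁ * ((β + (β₁ + ct * β)) * (1 - (β + (β₁ + ct * β)) * (R * cr) * cr)⁻¹) * cr)) + (θF * (1 * ((β + (β₁ + ct * β)) * (1 - (β + (β₁ + ct * β)) * (R * cr) * cr)⁻¹)) * cr)) + ((ε₀ * (1 - (β + (β₁ + ct * β)) * (R * cr) * cr)⁻¹) + 0)) * cr < 1) (j : J ⊕ J) :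
    HasMaj (BlockNorm.ofBlocks g (liftBlk blk ι)) (BlockNorm.ofBlocks g (liftBlk (blk ∘ π) ι))
      (idef (pull (liftMap π ι)) (pull (liftMap π ι))
        (Sum.elim (fun μ => fgrad η'⁻¹ (liftEquiv (τ' μ) ι)) (fun μ => bgrad η'⁻¹ (liftEquiv (τ' μ) ι)) j ∘ₗ glueInv (parametrix (fun k (p : X' × ι) => hX' k p.1) (fun k => mmulOp (fun _ => (coordMat e (ContinuousLinearMap.mulLeftRight ℝ (Matrix m m ℂ) (1 : Matrix m m ℂ) (1 : Matrix m m ℂ)ᴴ))ᵀ) ∘ₗ (projO none ∘ₗ bgPropV (stack (mulOp (fun p : X' × ι => χtX' k p.1) ∘ₗ N' k) (fun j => Sum.elim (fun μ => fgrad η'⁻¹ (liftEquiv (τ' μ) ι)) (fun μ => bgrad η'⁻¹ (liftEquiv (τ' μ) ι)) j ∘ₗ (mulOp (fun p : X' × ι => χtX' k p.1) ∘ₗ N' k))) (mulOp (fun p : X' × ι => ψX' k p.1) ∘ₗ (unstackM (tCoefC η' (gaugePair τ' fun μ x' => coordMat e (ContinuousLinearMap.mulLeftRight ℝ (Matrix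 m m ℂ) ((1 : Matrix m m ℂ) * U' μ x' * (1 : Matrix m m ℂ)ᴴ) ((1 : Matrix m m ℂ) * U' μ x' * (1 : Matrix m m ℂ)ᴴ)ᴴ)))
            (tCoefA η' (gaugePair τ' fun μ x' => coordMat e (ContinuousLinearMap.mulLeftRight ℝ (Matrix m m ℂ) ((1 : Matrix m m ℂ) * U' μ x' * (1 : Matrix m m ℂ)ᴴ) ((1 : Matrix m m ℂ) * U' μ x' * (1 : Matrix m m ℂ)ᴴ)ᴴ))) + NV' k ∘ₗ projO none) ∘ₗ mulOp (fun q : (X' × ι) × Option (J ⊕ J) => χX' k q.1.1))) ∘ₗ mmulOp (fun _ => coordMat e (ContinuousLinearMap.mulLeftRight ℝ (Matrix m m ℂ) (1 : Matrix m m ℂ) (1 : Matrix m m ℂ)ᴴ))))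
          (remainder (covLapM τ' η' (gaugePair τ' (fun μ x' => coordMat e (ContinuousLinearMap.mulLeftRight ℝ (Matrix m m ℂ) (U' μ x') (U' μ x')ᴴ))) + P') (fun k (p : X' × ι) => hX' k p.1) (fun k => mmulOp (fun _ => (coordMat e (ContinuousLinearMap.mulLeftRight ℝ (Matrix m m ℂ) (1 : Matrix m m ℂ) (1 : Matrix m m ℂ)ᴴ))ᵀ) ∘ₗ (projO none ∘ₗ bgPropV (stack (mulOp (fun p : X' × ι => χtX' k p.1) ∘ₗ N' k) (fun j => Sum.elim (fun μ => fgrad η'⁻¹ (liftEquiv (τ' μ) ι)) (fun μ => bgrad η'⁻¹ (liftEquiv (τ' μ) ι)) j ∘ₗ (mulOp (fun p : X' × ι => χtX' k p.1) ∘ₗ N' k))) (mulOp (fun p : X' × ι => ψX' k p.1) ∘ₗ (unstackM (tCoefC η' (gaugePair τ' fun μ x' => coordMat e (ContinuousLinearMap.mulLeftRight ℝ (Matrix m m ℂ) ((1 : Matrix m m ℂ) * U' μ x' * (1 : Matrix m m ℂ)ᴴ) ((1 : Matrix m m ℂ) * U' μ x' * (1 : Matrix m m ℂ)ᴴ)ᴴ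)))
            (tCoefA η' (gaugePair τ' fun μ x' => coordMat e (ContinuousLinearMap.mulLeftRight ℝ (Matrix m m ℂ) ((1 : Matrix m m ℂ) * U' μ x' * (1 : Matrix m m ℂ)ᴴ) ((1 : Matrix m m ℂ) * U' μ x' * (1 : Matrix m m ℂ)ᴴ)ᴴ))) + NV' k ∘ₗ projO none) ∘ₗ mulOp (fun q : (X' × ι) × Option (J ⊕ J) => χX' k q.1.1))) ∘ₗ mmulOp (fun _ => coordMat e (ContinuousLinearMap.mulLeftRight ℝ (Matrix m m ℂ) (1 : Matrix m m ℂ) (1 : Matrix m m ℂ)ᴴ))) -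
            ∑ k, (mmulOp (fun _ => (coordMat e (ContinuousLinearMap.mulLeftRight ℝ (Matrix m m ℂ) (1 : Matrix m m ℂ) (1 : Matrix m m ℂ)ᴴ))ᵀ) ∘ₗ ((((-(mulOp (fun p : X' × ι => hX' k p.1) ∘ₗ NL' ∘ₗ mulOp (1 - fun p : X' × ι => χtX' k p.1))) ∘ₗ N' k) ∘ₗ (LinearMap.id + ((mulOp (fun p : X' × ι => ψX' k p.1) ∘ₗ (unstackM (tCoefC η' (gaugePair τ' fun μ x' => coordMat e (ContinuousLinearMap.mulLeftRight ℝ (Matrix m m ℂ) ((1 : Matrix m m ℂ) * U' μ x' * (1 : Matrix m m ℂ)ᴴ) ((1 : Matrix m m ℂ) * U' μ x' * (1 : Matrix m m ℂ)ᴴ)ᴴ)))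
            (tCoefA η' (gaugePair τ' fun μ x' => coordMat e (ContinuousLinearMap.mulLeftRight ℝ (Matrix m m ℂ) ((1 : Matrix m m ℂ) * U' μ x' * (1 : Matrix m m ℂ)ᴴ) ((1 : Matrix m m ℂ) * U' μ x' * (1 : Matrix m m ℂ)ᴴ)ᴴ))) + NV' k ∘ₗ projO none) ∘ₗ mulOp (fun q : (X' × ι) × Option (J ⊕ J) => χX' k q.1.1)) ∘ₗ stack LinearMap.id (fun j => Sum.elim (fun μ => fgrad η'⁻¹ (liftEquiv (τ' μ) ι)) (fun μ => bgrad η'⁻¹ (liftEquiv (τ' μ) ι)) j)) ∘ₗ (projO none ∘ₗ bgPropV (stack (mulOp (fun p : X' × ι => χtX' k p.1) ∘ₗ N' k) (fun j => Sum.elim (fun μ => fgrad η'⁻¹ (liftEquiv (τ' μ) ι)) (fun μ => bgrad η'⁻¹ (liftEquiv (τ' μ) ι)) j ∘ₗ (mulOp (fun p : X' × ι => χtX' k p.1) ∘ₗ N' k))) (mulOp (fun p : X' × ι => ψX' k p.1) ∘ₗ (unstackM (tCoefC η' (gaugePair τ' fun μ x' => coordMat e (ContinuousLinearMap.mulLeftRight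 ℝ (Matrix m m ℂ) ((1 : Matrix m m ℂ) * U' μ x' * (1 : Matrix m m ℂ)ᴴ) ((1 : Matrix m m ℂ) * U' μ x' * (1 : Matrix m m ℂ)ᴴ)ᴴ)))
            (tCoefA η' (gaugePair τ' fun μ x' => coordMat e (ContinuousLinearMap.mulLeftRight ℝ (Matrix m m ℂ) ((1 : Matrix m m ℂ) * U' μ x' * (1 : Matrix m m ℂ)ᴴ) ((1 : Matrix m m ℂ) * U' μ x' * (1 : Matrix m m ℂ)ᴴ)ᴴ))) + NV' k ∘ₗ projO none) ∘ₗ mulOp (fun q : (X' × ι) × Option (J ⊕ J) => χX' k q.1.1)))) + mulOp (fun p : X' × ι => hX' k p.1) ∘ₗ (-(((unstackM (tCoefC η' (gaugePair τ' fun μ x' => coordMat e (ContinuousLinearMap.mulLeftRight ℝ (Matrix m m ℂ) ((1 : Matrix m m ℂ) * U' μ x' * (1 : Matrix m m ℂ)ᴴ) ((1 : Matrix m m ℂ) * U' μ x' * (1 : Matrix m m ℂ)ᴴ)ᴴ)))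
            (tCoefA η' (gaugePair τ' fun μ x' => coordMat e (ContinuousLinearMap.mulLeftRight ℝ (Matrix m m ℂ) ((1 : Matrix m m ℂ) * U' μ x' * (1 : Matrix m m ℂ)ᴴ) ((1 : Matrix m m ℂ) * U' μ x' * (1 : Matrix m m ℂ)ᴴ)ᴴ))) + NV' k ∘ₗ projO none) - mulOp (fun p : X' × ι => ψX' k p.1) ∘ₗ (unstackM (tCoefC η' (gaugePair τ' fun μ x' => coordMat e (ContinuousLinearMap.mulLeftRight ℝ (Matrix m m ℂ) ((1 : Matrix m m ℂ) * U' μ x' * (1 : Matrix m m ℂ)ᴴ) ((1 : Matrix m m ℂ) * U' μ x' * (1 : Matrix m m ℂ)ᴴ)ᴴ)))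
            (tCoefA η' (gaugePair τ' fun μ x' => coordMat e (ContinuousLinearMap.mulLeftRight ℝ (Matrix m m ℂ) ((1 : Matrix m m ℂ) * U' μ x' * (1 : Matrix m m ℂ)ᴴ) ((1 : Matrix m m ℂ) * U' μ x' * (1 : Matrix m m ℂ)ᴴ)ᴴ))) + NV' k ∘ₗ projO none) ∘ₗ mulOp (fun q : (X' × ι) × Option (J ⊕ J) => χX' k q.1.1)) ∘ₗ stack LinearMap.id (fun j => Sum.elim (fun μ => fgrad η'⁻¹ (liftEquiv (τ' μ) ι)) (fun μ => bgrad η'⁻¹ (liftEquiv (τ' μ) ι)) j))) ∘ₗ (projO none ∘ₗ bgPropV (stack (mulOp (fun p : X' × ι => χtX' k p.1) ∘ₗ N' k) (fun j => Sum.elim (fun μ => fgrad η'⁻¹ (liftEquiv (τ' μ) ι)) (fun μ => bgrad η'⁻¹ (liftEquiv (τ' μ) ι)) j ∘ₗ (mulOp (fun p : X' × ι => χtX' k p.1) ∘ₗ N' k))) (mulOp (fun p : X' × ι => ψX' k p.1) ∘ₗ (unstackM (tCoefC η' (gaugePair τ' fun μ x' => coordMat e (ContinuousLinearMap.mulLeftRight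 ℝ (Matrix m m ℂ) ((1 : Matrix m m ℂ) * U' μ x' * (1 : Matrix m m ℂ)ᴴ) ((1 : Matrix m m ℂ) * U' μ x' * (1 : Matrix m m ℂ)ᴴ)ᴴ)))
            (tCoefA η' (gaugePair τ' fun μ x' => coordMat e (ContinuousLinearMap.mulLeftRight ℝ (Matrix m m ℂ) ((1 : Matrix m m ℂ) * U' μ x' * (1 : Matrix m m ℂ)ᴴ) ((1 : Matrix m m ℂ) * U' μ x' * (1 : Matrix m m ℂ)ᴴ)ᴴ))) + NV' k ∘ₗ projO none) ∘ₗ mulOp (fun q : (X' × ι) × Option (J ⊕ J) => χX' k q.1.1))))) ∘ₗ mmulOp (fun _ => coordMat e (ContinuousLinearMap.mulLeftRight ℝ (Matrix m m ℂ) (1 : Matrix m m ℂ) (1 : Matrix m m ℂ)ᴴ))) ∘ₗ mulOp (fun p : X' × ι => hX' k p.1)))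
        (Sum.elim (fun μ => fgrad η⁻¹ (liftEquiv (τ μ) ι)) (fun μ => bgrad η⁻¹ (liftEquiv (τ μ) ι)) j ∘ₗ glueInv (parametrix (fun k (p : X × ι) => hX k p.1) (fun k => mmulOp (fun _ => (coordMat e (ContinuousLinearMap.mulLeftRight ℝ (Matrix m m ℂ) (1 : Matrix m m ℂ) (1 : Matrix m m ℂ)ᴴ))ᵀ) ∘ₗ (projO none ∘ₗ bgPropV (stack (mulOp (fun p : X × ι => χtX k p.1) ∘ₗ N k) (fun j => Sum.elim (fun μ => fgrad η⁻¹ (liftEquiv (τ μ) ι)) (fun μ => bgrad η⁻¹ (liftEquiv (τ μ) ι)) j ∘ₗ (mulOp (fun p : X × ι => χtX k p.1) ∘ₗ N k))) (mulOp (fun p : X × ι => ψX k p.1) ∘ₗ (unstackM (tCoefC η (gaugePair τ fun μ x => coordMat e (ContinuousLinearMap.mulLeftRight ℝ (Matrix m m ℂ) ((1 : Matrix m m ℂ) * U μ x * (1 : Matrix m m ℂ)ᴴ) ((1 : Matrix m m ℂ) * U μ x * (1 : Matrix m m ℂ)ᴴ)ᴴ)))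
            (tCoefA η (gaugePair τ fun μ x => coordMat e (ContinuousLinearMap.mulLeftRight ℝ (Matrix m m ℂ) ((1 : Matrix m m ℂ) * U μ x * (1 : Matrix m m ℂ)ᴴ) ((1 : Matrix m m ℂ) * U μ x * (1 : Matrix m m ℂ)ᴴ)ᴴ))) + NV k ∘ₗ projO none) ∘ₗ mulOp (fun q : (X × ι) × Option (J ⊕ J) => χX k q.1.1))) ∘ₗ mmulOp (fun _ => coordMat e (ContinuousLinearMap.mulLeftRight ℝ (Matrix m m ℂ) (1 : Matrix m m ℂ) (1 : Matrix m m ℂ)ᴴ))))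
          (remainder (covLapM τ η (gaugePair τ (fun μ x => coordMat e (ContinuousLinearMap.mulLeftRight ℝ (Matrix m m ℂ) (U μ x) (U μ x)ᴴ))) + P) (fun k (p : X × ι) => hX k p.1) (fun k => mmulOp (fun _ => (coordMat e (ContinuousLinearMap.mulLeftRight ℝ (Matrix m m ℂ) (1 : Matrix m m ℂ) (1 : Matrix m m ℂ)ᴴ))ᵀ) ∘ₗ (projO none ∘ₗ bgPropV (stack (mulOp (fun p : X × ι => χtX k p.1) ∘ₗ N k) (fun j => Sum.elim (fun μ => fgrad η⁻¹ (liftEquiv (τ μ) ι)) (fun μ => bgrad η⁻¹ (liftEquiv (τ μ) ι)) j ∘ₗ (mulOp (fun p : X × ι => χtX k p.1) ∘ₗ N k))) (mulOp (fun p : X × ι => ψX k p.1) ∘ₗ (unstackM (tCoefC η (gaugePair τ fun μ x => coordMat e (ContinuousLinearMap.mulLeftRight ℝ (Matrix m m ℂ) ((1 : Matrix m m ℂ) * U μ x * (1 : Matrix m m ℂ)ᴴ) ((1 : Matrix m m ℂ) * U μ x * (1 : Matrix m m ℂ)ᴴ)ᴴ)))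
            (tCoefA η (gaugePair τ fun μ x => coordMat e (ContinuousLinearMap.mulLeftRight ℝ (Matrix m m ℂ) ((1 : Matrix m m ℂ) * U μ x * (1 : Matrix m m ℂ)ᴴ) ((1 : Matrix m m ℂ) * U μ x * (1 : Matrix m m ℂ)ᴴ)ᴴ))) + NV k ∘ₗ projO none) ∘ₗ mulOp (fun q : (X × ι) × Option (J ⊕ J) => χX k q.1.1))) ∘ₗ mmulOp (fun _ => coordMat e (ContinuousLinearMap.mulLeftRight ℝ (Matrix m m ℂ) (1 : Matrix m m ℂ) (1 : Matrix m m ℂ)ᴴ))) -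
            ∑ k, (mmulOp (fun _ => (coordMat e (ContinuousLinearMap.mulLeftRight ℝ (Matrix m m ℂ) (1 : Matrix m m ℂ) (1 : Matrix m m ℂ)ᴴ))ᵀ) ∘ₗ ((((-(mulOp (fun p : X × ι => hX k p.1) ∘ₗ NL ∘ₗ mulOp (1 - fun p : X × ι => χtX k p.1))) ∘ₗ N k) ∘ₗ (LinearMap.id + ((mulOp (fun p : X × ι => ψX k p.1) ∘ₗ (unstackM (tCoefC η (gaugePair τ fun μ x => coordMat e (ContinuousLinearMap.mulLeftRight ℝ (Matrix m m ℂ) ((1 : Matrix m m ℂ) * U μ x * (1 : Matrix m m ℂ)ᴴ) ((1 : Matrix m m ℂ) * U μ x * (1 : Matrix m m ℂ)ᴴ)ᴴ)))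
            (tCoefA η (gaugePair τ fun μ x => coordMat e (ContinuousLinearMap.mulLeftRight ℝ (Matrix m m ℂ) ((1 : Matrix m m ℂ) * U μ x * (1 : Matrix m m ℂ)ᴴ) ((1 : Matrix m m ℂ) * U μ x * (1 : Matrix m m ℂ)ᴴ)ᴴ))) + NV k ∘ₗ projO none) ∘ₗ mulOp (fun q : (X × ι) × Option (J ⊕ J) => χX k q.1.1)) ∘ₗ stack LinearMap.id (fun j => Sum.elim (fun μ => fgrad η⁻¹ (liftEquiv (τ μ) ι)) (fun μ => bgrad η⁻¹ (liftEquiv (τ μ) ι)) j)) ∘ₗ (projO none ∘ₗ bgPropV (stack (mulOp (fun p : X × ι => χtX k p.1) ∘ₗ N k) (fun j => Sum.elim (fun μ => fgrad η⁻¹ (liftEquiv (τ μ) ι)) (fun μ => bgrad η⁻¹ (liftEquiv (τ μ) ι)) j ∘ₗ (mulOp (fun p : X × ι => χtX k p.1) ∘ₗ N k))) (mulOp (fun p : X × ι => ψX k p.1) ∘ₗ (unstackM (tCoefC η (gaugePair τ fun μ x => coordMat e (ContinuousLinearMap.mulLeftRight ℝ (Matrix m m ℂ) ((1 : Matrix m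 m ℂ) * U μ x * (1 : Matrix m m ℂ)ᴴ) ((1 : Matrix m m ℂ) * U μ x * (1 : Matrix m m ℂ)ᴴ)ᴴ)))
            (tCoefA η (gaugePair τ fun μ x => coordMat e (ContinuousLinearMap.mulLeftRight ℝ (Matrix m m ℂ) ((1 : Matrix m m ℂ) * U μ x * (1 : Matrix m m ℂ)ᴴ) ((1 : Matrix m m ℂ) * U μ x * (1 : Matrix m m ℂ)ᴴ)ᴴ))) + NV k ∘ₗ projO none) ∘ₗ mulOp (fun q : (X × ι) × Option (J ⊕ J) => χX k q.1.1)))) + mulOp (fun p : X × ι => hX k p.1) ∘ₗ (-(((unstackM (tCoefC η (gaugePair τ fun μ x => coordMat e (ContinuousLinearMap.mulLeftRight ℝ (Matrix m m ℂ) ((1 : Matrix m m ℂ) * U μ x * (1 : Matrix m m ℂ)ᴴ) ((1 : Matrix m m ℂ) * U μ x * (1 : Matrix m m ℂ)ᴴ)ᴴ)))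
            (tCoefA η (gaugePair τ fun μ x => coordMat e (ContinuousLinearMap.mulLeftRight ℝ (Matrix m m ℂ) ((1 : Matrix m m ℂ) * U μ x * (1 : Matrix m m ℂ)ᴴ) ((1 : Matrix m m ℂ) * U μ x * (1 : Matrix m m ℂ)ᴴ)ᴴ))) + NV k ∘ₗ projO none) - mulOp (fun p : X × ι => ψX k p.1) ∘ₗ (unstackM (tCoefC η (gaugePair τ fun μ x => coordMat e (ContinuousLinearMap.mulLeftRight ℝ (Matrix m m ℂ) ((1 : Matrix m m ℂ) * U μ x * (1 : Matrix m m ℂ)ᴴ) ((1 : Matrix m m ℂ) * U μ x * (1 : Matrix m m ℂ)ᴴ)ᴴ)))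
            (tCoefA η (gaugePair τ fun μ x => coordMat e (ContinuousLinearMap.mulLeftRight ℝ (Matrix m m ℂ) ((1 : Matrix m m ℂ) * U μ x * (1 : Matrix m m ℂ)ᴴ) ((1 : Matrix m m ℂ) * U μ x * (1 : Matrix m m ℂ)ᴴ)ᴴ))) + NV k ∘ₗ projO none) ∘ₗ mulOp (fun q : (X × ι) × Option (J ⊕ J) => χX k q.1.1)) ∘ₗ stack LinearMap.id (fun j => Sum.elim (fun μ => fgrad η⁻¹ (liftEquiv (τ μ) ι)) (fun μ => bgrad η⁻¹ (liftEquiv (τ μ) ι)) j))) ∘ₗ (projO none ∘ₗ bgPropV (stack (mulOp (fun p : X × ι => χtX k p.1) ∘ₗ N k) (fun j => Sum.elim (fun μ => fgrad η⁻¹ (liftEquiv (τ μ) ι)) (fun μ => bgrad η⁻¹ (liftEquiv (τ μ) ι)) j ∘ₗ (mulOp (fun p : X × ι => χtX k p.1) ∘ₗ N k))) (mulOp (fun p : X × ι => ψX k p.1) ∘ₗ (unstackM (tCoefC η (gaugePair τ fun μ x => coordMat e (ContinuousLinearMap.mulLeftRight ℝ (Matrix m m ℂ) ((1 : Matrix m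 m ℂ) * U μ x * (1 : Matrix m m ℂ)ᴴ) ((1 : Matrix m m ℂ) * U μ x * (1 : Matrix m m ℂ)ᴴ)ᴴ)))
            (tCoefA η (gaugePair τ fun μ x => coordMat e (ContinuousLinearMap.mulLeftRight ℝ (Matrix m m ℂ) ((1 : Matrix m m ℂ) * U μ x * (1 : Matrix m m ℂ)ᴴ) ((1 : Matrix m m ℂ) * U μ x * (1 : Matrix m m ℂ)ᴴ)ᴴ))) + NV k ∘ₗ projO none) ∘ₗ mulOp (fun q : (X × ι) × Option (J ⊕ J) => χX k q.1.1))))) ∘ₗ mmulOp (fun _ => coordMat e (ContinuousLinearMap.mulLeftRight ℝ (Matrix m m ℂ) (1 : Matrix m m ℂ) (1 : Matrix m m ℂ)ᴴ))) ∘ₗ mulOp (fun p : X × ι => hX k p.1))))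
      (fun y y' => (Nov * (1 * ((β + (β₁ + ct * β)) * (1 - (β + (β₁ + ct * β)) * (R * cr) * cr)⁻¹) + c₁ * ((β + (β₁ + ct * β)) * (1 - (β + (β₁ + ct * β)) * (R * cr) * cr)⁻¹)) * ((1 - Nov * ((((((Fintype.card J : ℝ) * (c₂ * ((β + (β₁ + ct * β)) * (1 - (β + (β₁ + ct * β)) * (R * cr) * cr)⁻¹) + 2 * (c₁ * ((β + (β₁ + ct * β)) * (1 - (β + (β₁ + ct * β)) * (R * cr) * cr)⁻¹))) + θW + cN * ((β + (β₁ + ct * β)) * (1 - (β + (β₁ + ct * β)) * (R * cr) * cr)⁻¹) * cr)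
          + ((ℓ * (Real.exp 1 * ε)⁻¹ + 2 * (ω + ℓ * d₁)) * R * ((β + (β₁ + ct * β)) * (1 - (β + (β₁ + ct * β)) * (R * cr) * cr)⁻¹) * cr + R * c₁ * ((β + (β₁ + ct * β)) * (1 - (β + (β₁ + ct * β)) * (R * cr) * cr)⁻¹) * cr)) + (θF * (1 * ((β + (β₁ + ct * β)) * (1 - (β + (β₁ + ct * β)) * (R * cr) * cr)⁻¹)) * cr))) + (((ε₀ * (1 - (β + (β₁ + ct * β)) * (R * cr) * cr)⁻¹) + 0))) * cr)⁻¹ * ((1 - Nov * ((((((Fintype.card J : ℝ) * (c₂ * ((β + (β₁ + ct * β)) * (1 - (β + (β₁ + ct * β)) * (R * cr) * cr)⁻¹) + 2 * (c₁ * ((β + (β₁ + ct * β)) * (1 - (β + (β₁ + ct * β)) * (R * cr) * cr)⁻¹))) + θW + cN * ((β + (β₁ + ct * β)) * (1 - (β + (β₁ + ct * β)) * (R * cr) * cr)⁻¹) * cr)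
          + ((ℓ * (Real.exp 1 * ε)⁻¹ + 2 * (ω + ℓ * d₁)) * R * ((β + (β₁ + ct * β)) * (1 - (β + (β₁ + ct * β)) * (R * cr) * cr)⁻¹) * cr + R * c₁ * ((β + (β₁ + ct * β)) * (1 - (β + (β₁ + ct * β)) * (R * cr) * cr)⁻¹) * cr)) + (θF * (1 * ((β + (β₁ + ct * β)) * (1 - (β + (β₁ + ct * β)) * (R * cr) * cr)⁻¹)) * cr))) + (((ε₀ * (1 - (β + (β₁ + ct * β)) * (R * cr) * cr)⁻¹) + 0))) * cr)⁻¹ * (Nov * ((((((Fintype.card J : ℝ) * (c₂ * ((β + (β₁ + ct * β)) * (1 - (β + (β₁ + ct * β)) * (R * cr) * cr)⁻¹) + 2 * (c₁ * ((β + (β₁ + ct * β)) * (1 - (β + (β₁ + ct * β)) * (R * cr) * cr)⁻¹))) + θW + cN * ((β + (β₁ + ct * β)) * (1 - (β + (β₁ + ct * β)) * (R * cr) * cr)⁻¹) * cr)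
          + ((ℓ * (Real.exp 1 * ε)⁻¹ + 2 * (ω + ℓ * d₁)) * R * ((β + (β₁ + ct * β)) * (1 - (β + (β₁ + ct * β)) * (R * cr) * cr)⁻¹) * cr + R * c₁ * ((β + (β₁ + ct * β)) * (1 - (β + (β₁ + ct * β)) * (R * cr) * cr)⁻¹) * cr)) + (θF * (1 * ((β + (β₁ + ct * β)) * (1 - (β + (β₁ + ct * β)) * (R * cr) * cr)⁻¹)) * cr))) * oo + ((((((Fintype.card J * (c₂ * ((((m₀ + oχ * β) + (m₁ + oχ₁ * β₁ + ct * m₀ + oχ₂ * β)) * cr + 1 * (((m₀ + oχ * β) + (m₁ + oχ₁ * β₁ + ct * m₀ + oχ₂ * β)) * cr) * (R * ((β + (β₁ + ct * β)) * (1 - (β + (β₁ + ct * β)) * (R * cr) * cr)⁻¹) * cr) + (β + (β₁ + ct * β)) * o * cr * ((β + (β₁ + ct * β)) * (1 - (β + (β₁ + ct * β)) * (R * cr) * cr)⁻¹) * cr) * (1 - 1 * ((β + (β₁ + ct * β)) * (R * cr) * cr))⁻¹)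
              + o₂ * ((β + (β₁ + ct * β)) * (1 - (β + (β₁ + ct * β)) * (R * cr) * cr)⁻¹)
              + 2 * (c₁ * ((((m₀ + oχ * β) + (m₁ + oχ₁ * β₁ + ct * m₀ + oχ₂ * β)) * cr + 1 * (((m₀ + oχ * β) + (m₁ + oχ₁ * β₁ + ct * m₀ + oχ₂ * β)) * cr) * (R * ((β + (β₁ + ct * β)) * (1 - (β + (β₁ + ct * β)) * (R * cr) * cr)⁻¹) * cr) + (β + (β₁ + ct * β)) * o * cr * ((β + (β₁ + ct * β)) * (1 - (β + (β₁ + ct * β)) * (R * cr) * cr)⁻¹) * cr) * (1 - 1 * ((β + (β₁ + ct * β)) * (R * cr) * cr))⁻¹)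
                + o₁ * ((β + (β₁ + ct * β)) * (1 - (β + (β₁ + ct * β)) * (R * cr) * cr)⁻¹))) + rW)
          + (cN * ((((m₀ + oχ * β) + (m₁ + oχ₁ * β₁ + ct * m₀ + oχ₂ * β)) * cr + 1 * (((m₀ + oχ * β) + (m₁ + oχ₁ * β₁ + ct * m₀ + oχ₂ * β)) * cr) * (R * ((β + (β₁ + ct * β)) * (1 - (β + (β₁ + ct * β)) * (R * cr) * cr)⁻¹) * cr) + (β + (β₁ + ct * β)) * o * cr * ((β + (β₁ + ct * β)) * (1 - (β + (β₁ + ct * β)) * (R * cr) * cr)⁻¹) * cr) * (1 - 1 * ((β + (β₁ + ct * β)) * (R * cr) * cr))⁻¹) * cr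
              + rN * ((β + (β₁ + ct * β)) * (1 - (β + (β₁ + ct * β)) * (R * cr) * cr)⁻¹) * cr)
          + ((((ℓ * (Real.exp 1 * ε)⁻¹ + 2 * (ω + ℓ * d₁)) * R)
                * ((((m₀ + oχ * β) + (m₁ + oχ₁ * β₁ + ct * m₀ + oχ₂ * β)) * cr + 1 * (((m₀ + oχ * β) + (m₁ + oχ₁ * β₁ + ct * m₀ + oχ₂ * β)) * cr) * (R * ((β + (β₁ + ct * β)) * (1 - (β + (β₁ + ct * β)) * (R * cr) * cr)⁻¹) * cr) + (β + (β₁ + ct * β)) * o * cr * ((β + (β₁ + ct * β)) * (1 - (β + (β₁ + ct * β)) * (R * cr) * cr)⁻¹) * cr) * (1 - 1 * ((β + (β₁ + ct * β)) * (R * cr) * cr))⁻¹)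
              + ((ℓ * (Real.exp 1 * ε)⁻¹ + 2 * (ω + ℓ * d₁)) * o + 2 * R * (oo + c₁ / η'⁻¹ + c₁ / η⁻¹))
                * ((β + (β₁ + ct * β)) * (1 - (β + (β₁ + ct * β)) * (R * cr) * cr)⁻¹)
              + R * (c₁ * ((((m₀ + oχ * β) + (m₁ + oχ₁ * β₁ + ct * m₀ + oχ₂ * β)) * cr + 1 * (((m₀ + oχ * β) + (m₁ + oχ₁ * β₁ + ct * m₀ + oχ₂ * β)) * cr) * (R * ((β + (β₁ + ct * β)) * (1 - (β + (β₁ + ct * β)) * (R * cr) * cr)⁻¹) * cr) + (β + (β₁ + ct * β)) * o * cr * ((β + (β₁ + ct * β)) * (1 - (β + (β₁ + ct * β)) * (R * cr) * cr)⁻¹) * cr) * (1 - 1 * ((β + (β₁ + ct * β)) * (R * cr) * cr))⁻¹)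
                + o₁ * ((β + (β₁ + ct * β)) * (1 - (β + (β₁ + ct * β)) * (R * cr) * cr)⁻¹))
              + o * c₁ * ((β + (β₁ + ct * β)) * (1 - (β + (β₁ + ct * β)) * (R * cr) * cr)⁻¹)) * cr)))) + (θF * (1 * ((((m₀ + oχ * β) + (m₁ + oχ₁ * β₁ + ct * m₀ + oχ₂ * β)) * cr + 1 * (((m₀ + oχ * β) + (m₁ + oχ₁ * β₁ + ct * m₀ + oχ₂ * β)) * cr) * (R * ((β + (β₁ + ct * β)) * (1 - (β + (β₁ + ct * β)) * (R * cr) * cr)⁻¹) * cr) + (β + (β₁ + ct * β)) * o * cr * ((β + (β₁ + ct * β)) * (1 - (β + (β₁ + ct * β)) * (R * cr) * cr)⁻¹) * cr) * (1 - 1 * ((β + (β₁ + ct * β)) * (R * cr) * cr))⁻¹) + (1 * ((β + (β₁ + ct * β)) * (1 - (β + (β₁ + ct * β)) * (R * cr) * cr)⁻¹)) * oo) * cr + rD * (1 * ((β + (β₁ + ct * β)) * (1 - (β + (β₁ + ct * β)) * (R * cr) * cr)⁻¹)) * cr))) + ((((ε₀ * (1 - (β + (β₁ + ct * β)) * (R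 * cr) * cr)⁻¹) + 0)) * oo + ((((ε₀ * (R * ((((m₀ + oχ * β) + (m₁ + oχ₁ * β₁ + ct * m₀ + oχ₂ * β)) * cr + 1 * (((m₀ + oχ * β) + (m₁ + oχ₁ * β₁ + ct * m₀ + oχ₂ * β)) * cr) * (R * ((β + (β₁ + ct * β)) * (1 - (β + (β₁ + ct * β)) * (R * cr) * cr)⁻¹) * cr) + (β + (β₁ + ct * β)) * o * cr * ((β + (β₁ + ct * β)) * (1 - (β + (β₁ + ct * β)) * (R * cr) * cr)⁻¹) * cr) * (1 - 1 * ((β + (β₁ + ct * β)) * (R * cr) * cr))⁻¹) + o * ((β + (β₁ + ct * β)) * (1 - (β + (β₁ + ct * β)) * (R * cr) * cr)⁻¹)) * cr * cr + rF * (1 + R * ((β + (β₁ + ct * β)) * (1 - (β + (β₁ + ct * β)) * (R * cr) * cr)⁻¹) * cr * cr))) + 0))))) * cr) * cr) * cr +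
        Nov * ((1 * ((β + (β₁ + ct * β)) * (1 - (β + (β₁ + ct * β)) * (R * cr) * cr)⁻¹) * oo + 1 * ((((m₀ + oχ * β) + (m₁ + oχ₁ * β₁ + ct * m₀ + oχ₂ * β)) * cr + 1 * (((m₀ + oχ * β) + (m₁ + oχ₁ * β₁ + ct * m₀ + oχ₂ * β)) * cr) * (R * ((β + (β₁ + ct * β)) * (1 - (β + (β₁ + ct * β)) * (R * cr) * cr)⁻¹) * cr) + (β + (β₁ + ct * β)) * o * cr * ((β + (β₁ + ct * β)) * (1 - (β + (β₁ + ct * β)) * (R * cr) * cr)⁻¹) * cr) * (1 - 1 * ((β + (β₁ + ct * β)) * (R * cr) * cr))⁻¹) * 1 + (oo + c₁ / η'⁻¹ + c₁ / η⁻¹) * ((β + (β₁ + ct * β)) * (1 - (β + (β₁ + ct * β)) * (R * cr) * cr)⁻¹) * 1) + (c₁ * ((β + (β₁ + ct * β)) * (1 - (β + (β₁ + ct * β)) * (R * cr) * cr)⁻¹) * oo + c₁ * ((((m₀ + oχ * β) + (m₁ + oχ₁ * β₁ + ct * m₀ + oχ₂ * β)) * cr + 1 * (((m₀ + oχ * β)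 + (m₁ + oχ₁ * β₁ + ct * m₀ + oχ₂ * β)) * cr) * (R * ((β + (β₁ + ct * β)) * (1 - (β + (β₁ + ct * β)) * (R * cr) * cr)⁻¹) * cr) + (β + (β₁ + ct * β)) * o * cr * ((β + (β₁ + ct * β)) * (1 - (β + (β₁ + ct * β)) * (R * cr) * cr)⁻¹) * cr) * (1 - 1 * ((β + (β₁ + ct * β)) * (R * cr) * cr))⁻¹) * 1 + o₁ * ((β + (β₁ + ct * β)) * (1 - (β + (β₁ + ct * β)) * (R * cr) * cr)⁻¹) * 1)) * (1 - Nov * ((((((Fintype.card J : ℝ) * (c₂ * ((β + (β₁ + ct * β)) * (1 - (β + (β₁ + ct * β)) * (R * cr) * cr)⁻¹) + 2 * (c₁ * ((β + (β₁ + ct * β)) * (1 - (β + (β₁ + ct * β)) * (R * cr) * cr)⁻¹))) + θW + cN * ((β + (β₁ + ct * β)) * (1 - (β + (β₁ + ct * β)) * (R * cr) * cr)⁻¹) * cr)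
          + ((ℓ * (Real.exp 1 * ε)⁻¹ + 2 * (ω + ℓ * d₁)) * R * ((β + (β₁ + ct * β)) * (1 - (β + (β₁ + ct * β)) * (R * cr) * cr)⁻¹) * cr + R * c₁ * ((β + (β₁ + ct * β)) * (1 - (β + (β₁ + ct * β)) * (R * cr) * cr)⁻¹) * cr)) + (θF * (1 * ((β + (β₁ + ct * β)) * (1 - (β + (β₁ + ct * β)) * (R * cr) * cr)⁻¹)) * cr))) + (((ε₀ * (1 - (β + (β₁ + ct * β)) * (R * cr) * cr)⁻¹) + 0))) * cr)⁻¹ * cr) *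
        Real.exp (-((ρ₃ - 2 * σ) * g.dist y y'))) := by
  -- `w ≡ 1`: the gauge sandwiches are the identity (dag-n15-w2 `coordMat_conj_one`, `mmulOp_one`)
  simp only [coordMat_conj_one, Matrix.transpose_one, mmulOp_one, LinearMap.id_comp, LinearMap.comp_id]
  have hβb : 0 ≤ β + (β₁ + ct * β) := by positivity
  have hqi : 0 ≤ (1 - (β + (β₁ + ct * β)) * (R * cr) * cr)⁻¹ := inv_nonneg.2 (by linarith)
  have hq1 : 0 ≤ (1 - 1 * ((β + (β₁ + ct * β)) * (R * cr) * cr))⁻¹ := by rw [one_mul]; exact hqi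
  have hB : 0 ≤ ((β + (β₁ + ct * β)) * (1 - (β + (β₁ + ct * β)) * (R * cr) * cr)⁻¹) := mul_nonneg hβb hqi
  have hM : 0 ≤ (m₀ + oχ * β) + (m₁ + oχ₁ * β₁ + ct * m₀ + oχ₂ * β) :=
    add_nonneg (add_nonneg hm₀ (mul_nonneg hoχ hβ)) (add_nonneg (add_nonneg (add_nonneg hm₁ (mul_nonneg hoχ₁ hβ₁)) (mul_nonneg hct hm₀)) (mul_nonneg hoχ₂ hβ))
  have hAD : 0 ≤ ((((m₀ + oχ * β) + (m₁ + oχ₁ * β₁ + ct * m₀ + oχ₂ * β)) * cr +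
              1 * (((m₀ + oχ * β) + (m₁ + oχ₁ * β₁ + ct * m₀ + oχ₂ * β)) * cr) * (R * ((β + (β₁ + ct * β)) * (1 - (β + (β₁ + ct * β)) * (R * cr) * cr)⁻¹) * cr) +
            (β + (β₁ + ct * β)) * o * cr * ((β + (β₁ + ct * β)) * (1 - (β + (β₁ + ct * β)) * (R * cr) * cr)⁻¹) * cr) *
          (1 - 1 * ((β + (β₁ + ct * β)) * (R * cr) * cr))⁻¹) :=
    mul_nonneg (add_nonneg (add_nonneg (mul_nonneg hM hcr) (mul_nonneg (mul_nonneg zero_le_one (mul_nonneg hM hcr)) (mul_nonneg (mul_nonneg hR hB) hcr)))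
      (mul_nonneg (mul_nonneg (mul_nonneg (mul_nonneg hβb ho) hcr) hB) hcr)) hq1
  have hθF' : 0 ≤ (θF * (1 * ((β + (β₁ + ct * β)) * (1 - (β + (β₁ + ct * β)) * (R * cr) * cr)⁻¹)) * cr) := mul_nonneg (mul_nonneg hθF (mul_nonneg zero_le_one hB)) hcr
  have hrFK' : 0 ≤ (θF * (1 * ((((m₀ + oχ * β) + (m₁ + oχ₁ * β₁ + ct * m₀ + oχ₂ * β)) * cr +
              1 * (((m₀ + oχ * β) + (m₁ + oχ₁ * β₁ + ct * m₀ + oχ₂ * β)) * cr) * (R * ((β + (β₁ + ct * β)) * (1 - (β + (β₁ + ct * β)) * (R * cr) * cr)⁻¹) * cr) +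
            (β + (β₁ + ct * β)) * o * cr * ((β + (β₁ + ct * β)) * (1 - (β + (β₁ + ct * β)) * (R * cr) * cr)⁻¹) * cr) *
          (1 - 1 * ((β + (β₁ + ct * β)) * (R * cr) * cr))⁻¹) + (1 * ((β + (β₁ + ct * β)) * (1 - (β + (β₁ + ct * β)) * (R * cr) * cr)⁻¹)) * oo) * cr + rD * (1 * ((β + (β₁ + ct * β)) * (1 - (β + (β₁ + ct * β)) * (R * cr) * cr)⁻¹)) * cr) :=
    add_nonneg (mul_nonneg (mul_nonneg hθF (add_nonneg (mul_nonneg zero_le_one hAD) (mul_nonneg (mul_nonneg zero_le_one hB) hoo))) hcr) (mul_nonneg (mul_nonneg hrD (mul_nonneg zero_le_one hB)) hcr)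
  -- the covariance identities (`uN_localOp_eq_cut_add_farDefect` above), both grids
  have hcovW := fun k => by
    have h := uN_localOp_eq_cut_add_farDefect τ e (fun _ => (1 : Matrix m m ℂ)) U (χX k) (ψX k) η he (fun _ => by rw [Matrix.conjTranspose_one, Matrix.mul_one]) (hP k)
    simp only [coordMat_conj_one, Matrix.transpose_one, mmulOp_one, LinearMap.id_comp, LinearMap.comp_id] at h
    exact h
  have hcovW' := fun k => by
    have h := uN_localOp_eq_cut_add_farDefect τ' e (fun _ => (1 : Matrix m m ℂ)) U' (χX' k) (ψX' k) η' he (fun _ => by rw [Matrix.conjTranspose_one, Matrix.mul_one]) (hP' k)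
    simp only [coordMat_conj_one, Matrix.transpose_one, mmulOp_one, LinearMap.id_comp, LinearMap.comp_id] at h
    exact h
  -- the cube perturbations' letters and η-defect (file 51), both grids
  have hV : ∀ k, HasMaj (BlockNorm.ofBlocks g (blkPair (liftBlk blk ι))) (BlockNorm.ofBlocks g (liftBlk blk ι)) (mulOp (fun p : X × ι => ψX k p.1) ∘ₗ (unstackM (tCoefC η (gaugePair τ fun μ x => coordMat e (ContinuousLinearMap.mulLeftRight ℝ (Matrix m m ℂ) ((1 : Matrix m m ℂ) * U μ x * (1 : Matrix m m ℂ)ᴴ) ((1 : Matrix m m ℂ) * U μ x * (1 : Matrix m m ℂ)ᴴ)ᴴ)))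
            (tCoefA η (gaugePair τ fun μ x => coordMat e (ContinuousLinearMap.mulLeftRight ℝ (Matrix m m ℂ) ((1 : Matrix m m ℂ) * U μ x * (1 : Matrix m m ℂ)ᴴ) ((1 : Matrix m m ℂ) * U μ x * (1 : Matrix m m ℂ)ᴴ)ᴴ))) + NV k ∘ₗ projO none) ∘ₗ mulOp (fun q : (X × ι) × Option (J ⊕ J) => χX k q.1.1)) (fun y y' => R * Real.exp (-(δV * g.dist y y'))) := fun k =>
    (hasMaj_cutPert_structural_of_local blk hd0 hrV hRN (hχ1 k) (hCloc k) (fun μ x hx => hAloc k μ x hx) (hψχ k) (hNVcut k)).mono fun y y' =>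
      mul_le_mul_of_nonneg_right hRle (Real.exp_nonneg _)
  have hV' : ∀ k, HasMaj (BlockNorm.ofBlocks g (blkPair (liftBlk (blk ∘ π) ι))) (BlockNorm.ofBlocks g (liftBlk (blk ∘ π) ι)) (mulOp (fun p : X' × ι => ψX' k p.1) ∘ₗ (unstackM (tCoefC η' (gaugePair τ' fun μ x' => coordMat e (ContinuousLinearMap.mulLeftRight ℝ (Matrix m m ℂ) ((1 : Matrix m m ℂ) * U' μ x' * (1 : Matrix m m ℂ)ᴴ) ((1 : Matrix m m ℂ) * U' μ x' * (1 : Matrix m m ℂ)ᴴ)ᴴ)))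
            (tCoefA η' (gaugePair τ' fun μ x' => coordMat e (ContinuousLinearMap.mulLeftRight ℝ (Matrix m m ℂ) ((1 : Matrix m m ℂ) * U' μ x' * (1 : Matrix m m ℂ)ᴴ) ((1 : Matrix m m ℂ) * U' μ x' * (1 : Matrix m m ℂ)ᴴ)ᴴ))) + NV' k ∘ₗ projO none) ∘ₗ mulOp (fun q : (X' × ι) × Option (J ⊕ J) => χX' k q.1.1)) (fun y y' => R * Real.exp (-(δV * g.dist y y'))) := fun k =>
    (hasMaj_cutPert_structural_of_local (blk ∘ π) hd0 hrV hRN (hχ1' k) (hCloc' k) (fun μ x' hx => hAloc' k μ x' hx) (hψχ' k) (hNVcut' k)).mono fun y y' =>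
      mul_le_mul_of_nonneg_right hRle (Real.exp_nonneg _)
  have hDV : ∀ k, HasMaj (BlockNorm.ofBlocks g (blkPair (liftBlk blk ι))) (BlockNorm.ofBlocks g (liftBlk (blk ∘ π) ι))
      (idef (pull (liftPair (liftMap π ι))) (pull (liftMap π ι)) (mulOp (fun p : X' × ι => ψX' k p.1) ∘ₗ (unstackM (tCoefC η' (gaugePair τ' fun μ x' => coordMat e (ContinuousLinearMap.mulLeftRight ℝ (Matrix m m ℂ) ((1 : Matrix m m ℂ) * U' μ x' * (1 : Matrix m m ℂ)ᴴ) ((1 : Matrix m m ℂ) * U' μ x' * (1 : Matrix m m ℂ)ᴴ)ᴴ)))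
            (tCoefA η' (gaugePair τ' fun μ x' => coordMat e (ContinuousLinearMap.mulLeftRight ℝ (Matrix m m ℂ) ((1 : Matrix m m ℂ) * U' μ x' * (1 : Matrix m m ℂ)ᴴ) ((1 : Matrix m m ℂ) * U' μ x' * (1 : Matrix m m ℂ)ᴴ)ᴴ))) + NV' k ∘ₗ projO none) ∘ₗ mulOp (fun q : (X' × ι) × Option (J ⊕ J) => χX' k q.1.1))
        (mulOp (fun p : X × ι => ψX k p.1) ∘ₗ (unstackM (tCoefC η (gaugePair τ fun μ x => coordMat e (ContinuousLinearMap.mulLeftRight ℝ (Matrix m m ℂ) ((1 : Matrix m m ℂ) * U μ x * (1 : Matrix m m ℂ)ᴴ) ((1 : Matrix m m ℂ) * U μ x * (1 : Matrix m m ℂ)ᴴ)ᴴ)))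
            (tCoefA η (gaugePair τ fun μ x => coordMat e (ContinuousLinearMap.mulLeftRight ℝ (Matrix m m ℂ) ((1 : Matrix m m ℂ) * U μ x * (1 : Matrix m m ℂ)ᴴ) ((1 : Matrix m m ℂ) * U μ x * (1 : Matrix m m ℂ)ᴴ)ᴴ))) + NV k ∘ₗ projO none) ∘ₗ mulOp (fun q : (X × ι) × Option (J ⊕ J) => χX k q.1.1))) (fun y y' => o * Real.exp (-(δV * g.dist y y'))) := fun k =>
    (hasMaj_idef_cutPert_structural_of_local blk π hd0 hoV hoN (hψχ k) (hψχ' k) (hfitC k) (fun μ x' i => hfitA k μ x' i) (hDNV k)).mono fun y y' =>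
      mul_le_mul_of_nonneg_right hole (Real.exp_nonneg _)
  -- the `W`-rows vanish (`W = 0 = W′`), both grids and their defect
  have hW : ∀ k, HasMaj (BlockNorm.ofBlocks g (liftBlk blk ι)) (BlockNorm.ofBlocks g (liftBlk blk ι)) (commOp (0 : (X × ι → ℝ) →ₗ[ℝ] (X × ι → ℝ)) (fun p : X × ι => hX k p.1) ∘ₗ (projO none ∘ₗ bgPropV (stack (mulOp (fun p : X × ι => χtX k p.1) ∘ₗ N k)
          (fun j => Sum.elim (fun μ => fgrad η⁻¹ (liftEquiv (τ μ) ι)) (fun μ => bgrad η⁻¹ (liftEquiv (τ μ) ι)) j ∘ₗ (mulOp (fun p : X × ι => χtX k p.1) ∘ₗ N k))) (mulOp (fun p : X × ι => ψX k p.1) ∘ₗ (unstackM (tCoefC η (gaugePair τ fun μ x => coordMat e (ContinuousLinearMap.mulLeftRight ℝ (Matrix m m ℂ) ((1 : Matrix m m ℂ) * U μ x * (1 : Matrix m m ℂ)ᴴ) ((1 : Matrix m m ℂ) * U μ x * (1 : Matrix m m ℂ)ᴴ)ᴴ)))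
            (tCoefA η (gaugePair τ fun μ x => coordMat e (ContinuousLinearMap.mulLeftRight ℝ (Matrix m m ℂ) ((1 : Matrix m m ℂ) * U μ x * (1 : Matrix m m ℂ)ᴴ) ((1 : Matrix m m ℂ) * U μ x * (1 : Matrix m m ℂ)ᴴ)ᴴ))) + NV k ∘ₗ projO none) ∘ₗ mulOp (fun q : (X × ι) × Option (J ⊕ J) => χX k q.1.1))))
      (fun y y' => ind (Sk k) y * ind (Sk k) y' * (θW * Real.exp (-(ρ₂ * g.dist y y')))) := fun k => by
    rw [show commOp (0 : (X × ι → ℝ) →ₗ[ℝ] (X × ι → ℝ)) (fun p : X × ι => hX k p.1) = 0 from by simp [commOp], LinearMap.zero_comp]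
    exact (hasMaj_zero _ _).mono fun y y' => mul_nonneg (mul_nonneg (ind_nonneg _ _) (ind_nonneg _ _)) (mul_nonneg hθW (Real.exp_nonneg _))
  have hW' : ∀ k, HasMaj (BlockNorm.ofBlocks g (liftBlk (blk ∘ π) ι)) (BlockNorm.ofBlocks g (liftBlk (blk ∘ π) ι)) (commOp (0 : (X' × ι → ℝ) →ₗ[ℝ] (X' × ι → ℝ)) (fun p : X' × ι => hX' k p.1) ∘ₗ (projO none ∘ₗ bgPropV (stack (mulOp (fun p : X' × ι => χtX' k p.1) ∘ₗ N' k)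
          (fun j => Sum.elim (fun μ => fgrad η'⁻¹ (liftEquiv (τ' μ) ι)) (fun μ => bgrad η'⁻¹ (liftEquiv (τ' μ) ι)) j ∘ₗ (mulOp (fun p : X' × ι => χtX' k p.1) ∘ₗ N' k))) (mulOp (fun p : X' × ι => ψX' k p.1) ∘ₗ (unstackM (tCoefC η' (gaugePair τ' fun μ x' => coordMat e (ContinuousLinearMap.mulLeftRight ℝ (Matrix m m ℂ) ((1 : Matrix m m ℂ) * U' μ x' * (1 : Matrix m m ℂ)ᴴ) ((1 : Matrix m m ℂ) * U' μ x' * (1 : Matrix m m ℂ)ᴴ)ᴴ)))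
            (tCoefA η' (gaugePair τ' fun μ x' => coordMat e (ContinuousLinearMap.mulLeftRight ℝ (Matrix m m ℂ) ((1 : Matrix m m ℂ) * U' μ x' * (1 : Matrix m m ℂ)ᴴ) ((1 : Matrix m m ℂ) * U' μ x' * (1 : Matrix m m ℂ)ᴴ)ᴴ))) + NV' k ∘ₗ projO none) ∘ₗ mulOp (fun q : (X' × ι) × Option (J ⊕ J) => χX' k q.1.1))))
      (fun y y' => ind (Sk k) y * ind (Sk k) y' * (θW * Real.exp (-(ρ₂ * g.dist y y')))) := fun k => by
    rw [show commOp (0 : (X' × ι → ℝ) →ₗ[ℝ] (X' × ι → ℝ)) (fun p : X' × ι => hX' k p.1) = 0 from by simp [commOp], LinearMap.zero_comp]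
    exact (hasMaj_zero _ _).mono fun y y' => mul_nonneg (mul_nonneg (ind_nonneg _ _) (ind_nonneg _ _)) (mul_nonneg hθW (Real.exp_nonneg _))
  have hDW : ∀ k, HasMaj (BlockNorm.ofBlocks g (liftBlk blk ι)) (BlockNorm.ofBlocks g (liftBlk (blk ∘ π) ι))
      (idef (pull (liftMap π ι)) (pull (liftMap π ι)) (commOp (0 : (X' × ι → ℝ) →ₗ[ℝ] (X' × ι → ℝ)) (fun p : X' × ι => hX' k p.1) ∘ₗ (projO none ∘ₗ bgPropV (stack (mulOp (fun p : X' × ι => χtX' k p.1) ∘ₗ N' k)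
          (fun j => Sum.elim (fun μ => fgrad η'⁻¹ (liftEquiv (τ' μ) ι)) (fun μ => bgrad η'⁻¹ (liftEquiv (τ' μ) ι)) j ∘ₗ (mulOp (fun p : X' × ι => χtX' k p.1) ∘ₗ N' k))) (mulOp (fun p : X' × ι => ψX' k p.1) ∘ₗ (unstackM (tCoefC η' (gaugePair τ' fun μ x' => coordMat e (ContinuousLinearMap.mulLeftRight ℝ (Matrix m m ℂ) ((1 : Matrix m m ℂ) * U' μ x' * (1 : Matrix m m ℂ)ᴴ) ((1 : Matrix m m ℂ) * U' μ x' * (1 : Matrix m m ℂ)ᴴ)ᴴ)))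
            (tCoefA η' (gaugePair τ' fun μ x' => coordMat e (ContinuousLinearMap.mulLeftRight ℝ (Matrix m m ℂ) ((1 : Matrix m m ℂ) * U' μ x' * (1 : Matrix m m ℂ)ᴴ) ((1 : Matrix m m ℂ) * U' μ x' * (1 : Matrix m m ℂ)ᴴ)ᴴ))) + NV' k ∘ₗ projO none) ∘ₗ mulOp (fun q : (X' × ι) × Option (J ⊕ J) => χX' k q.1.1))))
        (commOp (0 : (X × ι → ℝ) →ₗ[ℝ] (X × ι → ℝ)) (fun p : X × ι => hX k p.1) ∘ₗ (projO none ∘ₗ bgPropV (stack (mulOp (fun p : X × ι => χtX k p.1) ∘ₗ N k)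
          (fun j => Sum.elim (fun μ => fgrad η⁻¹ (liftEquiv (τ μ) ι)) (fun μ => bgrad η⁻¹ (liftEquiv (τ μ) ι)) j ∘ₗ (mulOp (fun p : X × ι => χtX k p.1) ∘ₗ N k))) (mulOp (fun p : X × ι => ψX k p.1) ∘ₗ (unstackM (tCoefC η (gaugePair τ fun μ x => coordMat e (ContinuousLinearMap.mulLeftRight ℝ (Matrix m m ℂ) ((1 : Matrix m m ℂ) * U μ x * (1 : Matrix m m ℂ)ᴴ) ((1 : Matrix m m ℂ) * U μ x * (1 : Matrix m m ℂ)ᴴ)ᴴ)))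
            (tCoefA η (gaugePair τ fun μ x => coordMat e (ContinuousLinearMap.mulLeftRight ℝ (Matrix m m ℂ) ((1 : Matrix m m ℂ) * U μ x * (1 : Matrix m m ℂ)ᴴ) ((1 : Matrix m m ℂ) * U μ x * (1 : Matrix m m ℂ)ᴴ)ᴴ))) + NV k ∘ₗ projO none) ∘ₗ mulOp (fun q : (X × ι) × Option (J ⊕ J) => χX k q.1.1)))))
      (fun y y' => ind (Sk k) y * ind (Sk k) y' * (rW * Real.exp (-(ρ₂ * g.dist y y')))) := fun k =>
    hasMaj_idef_of_eq_zero (pull (liftMap π ι)) (by rw [show commOp (0 : (X' × ι → ℝ) →ₗ[ℝ] (X' × ι → ℝ)) (fun p : X' × ι => hX' k p.1) = 0 from by simp [commOp], LinearMap.zero_comp])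
      (by rw [show commOp (0 : (X × ι → ℝ) →ₗ[ℝ] (X × ι → ℝ)) (fun p : X × ι => hX k p.1) = 0 from by simp [commOp], LinearMap.zero_comp])
      fun y y' => mul_nonneg (mul_nonneg (ind_nonneg _ _) (ind_nonneg _ _)) (mul_nonneg hrW (Real.exp_nonneg _))
  -- the far-defect rows (file 49: `M_hFX = 0`; file 50: `[F, M_h]X` from the far letters) and their η-defects (file 50), both grids
  have hFX := fun k => hasMaj_mulOp_farDefect_smoothCutDressed blk τ η⁻¹ (Vf := (unstackM (tCoefC η (gaugePair τ fun μ x => coordMat e (ContinuousLinearMap.mulLeftRight ℝ (Matrix m m ℂ) ((1 : Matrix m m ℂ) * U μ x * (1 : Matrix m m ℂ)ᴴ) ((1 : Matrix m m ℂ) * U μ x * (1 : Matrix m m ℂ)ᴴ)ᴴ)))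
            (tCoefA η (gaugePair τ fun μ x => coordMat e (ContinuousLinearMap.mulLeftRight ℝ (Matrix m m ℂ) ((1 : Matrix m m ℂ) * U μ x * (1 : Matrix m m ℂ)ᴴ) ((1 : Matrix m m ℂ) * U μ x * (1 : Matrix m m ℂ)ᴴ)ᴴ))) + NV k ∘ₗ projO none)) htri hd hrow hσ hβ hβ₁ hct hR hcr hσρ hρ₁V hρ₁G hρ₂ hρ₂₁ (hχt k) (hdχt k) (hdχtb k) (hsub k) (hχ k) (hs k)
    (hsb k) (hdd k) (hddb k) (hs2 k) (hsb2 k) (hdd2 k) (hddb2 k) (hcut k) (hcutF k) (hcutB k) (hV k) hq (hhψ k) ρ₃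
  have hFX' := fun k => hasMaj_mulOp_farDefect_smoothCutDressed (blk ∘ π) τ' η'⁻¹ (Vf := (unstackM (tCoefC η' (gaugePair τ' fun μ x' => coordMat e (ContinuousLinearMap.mulLeftRight ℝ (Matrix m m ℂ) ((1 : Matrix m m ℂ) * U' μ x' * (1 : Matrix m m ℂ)ᴴ) ((1 : Matrix m m ℂ) * U' μ x' * (1 : Matrix m m ℂ)ᴴ)ᴴ)))
            (tCoefA η' (gaugePair τ' fun μ x' => coordMat e (ContinuousLinearMap.mulLeftRight ℝ (Matrix m m ℂ) ((1 : Matrix m m ℂ) * U' μ x' * (1 : Matrix m m ℂ)ᴴ) ((1 : Matrix m m ℂ) * U' μ x' * (1 : Matrix m m ℂ)ᴴ)ᴴ))) + NV' k ∘ₗ projO none)) htri hd hrow hσ hβ hβ₁ hct hR hcr hσρ hρ₁V hρ₁G hρ₂ hρ₂₁ (hχt' k) (hdχt' k) (hdχtb' k) (hsub' k)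
    (hχ' k) (hs' k) (hsb' k) (hdd' k) (hddb' k) (hs2' k) (hsb2' k) (hdd2' k) (hddb2' k) (hcut' k) (hcutF' k) (hcutB' k) (hV' k) hq (hhψf k) ρ₃
  have hFK := fun k => hasMaj_commOp_farDefect_structural blk τ η⁻¹ (NV := NV k) (Cc := tCoefC η (gaugePair τ fun μ x => coordMat e (ContinuousLinearMap.mulLeftRight ℝ (Matrix m m ℂ) ((1 : Matrix m m ℂ) * U μ x * (1 : Matrix m m ℂ)ᴴ) ((1 : Matrix m m ℂ) * U μ x * (1 : Matrix m m ℂ)ᴴ)ᴴ)))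
    (Ac := tCoefA η (gaugePair τ fun μ x => coordMat e (ContinuousLinearMap.mulLeftRight ℝ (Matrix m m ℂ) ((1 : Matrix m m ℂ) * U μ x * (1 : Matrix m m ℂ)ᴴ) ((1 : Matrix m m ℂ) * U μ x * (1 : Matrix m m ℂ)ᴴ)ᴴ))) htri hd hrow hσ hβ hβ₁ hct hR hcr hσρ hρ₁V hρ₁G hρ₂ hρ₂₁
    (hSχ k) (hSψ k) (hχt k) (hdχt k) (hdχtb k) (hsub k) (hχ k) (hs k) (hsb k) (hdd k) (hddb k) (hs2 k) (hsb2 k) (hdd2 k) (hddb2 k) (hNψ k) (hcut k) (hcutF k) (hcutB k) (hV k) hq hθF hρ₃ hρ₃₂ hρF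
    (hhabs k) (hhψ k) (hχh k) (hhs' k) (hhsb' k) (hhdd' k) (hhddb' k) (hψχ k) (hfarN k)
  have hFK' := fun k => hasMaj_commOp_farDefect_structural (blk ∘ π) τ' η'⁻¹ (NV := NV' k) (Cc := tCoefC η' (gaugePair τ' fun μ x' => coordMat e (ContinuousLinearMap.mulLeftRight ℝ (Matrix m m ℂ) ((1 : Matrix m m ℂ) * U' μ x' * (1 : Matrix m m ℂ)ᴴ) ((1 : Matrix m m ℂ) * U' μ x' * (1 : Matrix m m ℂ)ᴴ)ᴴ)))
    (Ac := tCoefA η' (gaugePair τ' fun μ x' => coordMat e (ContinuousLinearMap.mulLeftRight ℝ (Matrix m m ℂ) ((1 : Matrix m m ℂ) * U' μ x' * (1 : Matrix m m ℂ)ᴴ) ((1 : Matrix m m ℂ) * U' μ x' * (1 : Matrix m m ℂ)ᴴ)ᴴ))) htri hd hrow hσ hβ hβ₁ hct hR hcr hσρ hρ₁V hρ₁G hρ₂ hρ₂₁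
    (hSχ' k) (hSψ' k) (hχt' k) (hdχt' k) (hdχtb' k) (hsub' k) (hχ' k) (hs' k) (hsb' k) (hdd' k) (hddb' k) (hs2' k) (hsb2' k) (hdd2' k) (hddb2' k) (hNψ' k) (hcut' k) (hcutF' k) (hcutB' k) (hV' k) hq
    hθF hρ₃ hρ₃₂ hρF (hhabs' k) (hhψf k) (hχhf k) (hhsf k) (hhsbf k) (hhddf k) (hhddbf k) (hψχ' k) (hfarN' k)
  have hDFK := fun k => hasMaj_idef_commOp_farDefect_structural blk π τ τ' η⁻¹ η'⁻¹ (NV := NV k) (NV' := NV' k) (Cc := tCoefC η (gaugePair τ fun μ x => coordMat e (ContinuousLinearMap.mulLeftRight ℝ (Matrix m m ℂ) ((1 : Matrix m m ℂ) * U μ x * (1 : Matrix m m ℂ)ᴴ) ((1 : Matrix m m ℂ) * U μ x * (1 : Matrix m m ℂ)ᴴ)ᴴ)))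
    (Ac := tCoefA η (gaugePair τ fun μ x => coordMat e (ContinuousLinearMap.mulLeftRight ℝ (Matrix m m ℂ) ((1 : Matrix m m ℂ) * U μ x * (1 : Matrix m m ℂ)ᴴ) ((1 : Matrix m m ℂ) * U μ x * (1 : Matrix m m ℂ)ᴴ)ᴴ)))
    (Cc' := tCoefC η' (gaugePair τ' fun μ x' => coordMat e (ContinuousLinearMap.mulLeftRight ℝ (Matrix m m ℂ) ((1 : Matrix m m ℂ) * U' μ x' * (1 : Matrix m m ℂ)ᴴ) ((1 : Matrix m m ℂ) * U' μ x' * (1 : Matrix m m ℂ)ᴴ)ᴴ)))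
    (Ac' := tCoefA η' (gaugePair τ' fun μ x' => coordMat e (ContinuousLinearMap.mulLeftRight ℝ (Matrix m m ℂ) ((1 : Matrix m m ℂ) * U' μ x' * (1 : Matrix m m ℂ)ᴴ) ((1 : Matrix m m ℂ) * U' μ x' * (1 : Matrix m m ℂ)ᴴ)ᴴ))) htri hd hrow hσ hcr hβ hβ₁ hct hm₀ hm₁ hoχ hoχ₁ hoχ₂ hR ho hσρ hρ₁V hρ₁G hρ₂ hρ₂₁
    (hSχ k) (hSψ k) (hSχ' k) (hSψ' k) (hχt k) (hdχt k) (hdχtb k) (hsub k) (hχ k) (hs k) (hsb k) (hdd k) (hddb k) (hNψ k) (hχt' k) (hdχt' k) (hdχtb' k) (hsub' k) (hχ' k) (hs' k) (hsb' k)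
    (hdd' k) (hddb' k) (hNψ' k) (hfitχ k) (hfit₁ k) (hfit₁b k) (hfit₂ k) (hfit₂b k) (hcut k) (hcutF k) (hcutB k) (hcut' k) (hcutF' k) (hcutB' k) (hDcut k) (hDcutF k) (hDcutB k) (hV k)
    (hV' k) (hDV k) (hs2 k) (hsb2 k) (hdd2 k) (hddb2 k) (hs2' k) (hsb2' k) (hdd2' k) (hddb2' k) (hhabs k) (hhabs' k) (hfh k) hoo (hhψ k) (hχh k) (hhs' k) (hhsb' k) (hhdd' k) (hhddb' k)
    (hψχ k) (hhψf k) (hχhf k) (hhsf k) (hhsbf k) (hhddf k) (hhddbf k) (hψχ' k) hθF hrD hρ₃ hρ₃₂ hρF (hfarN' k) (hDfarN k) hq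
  have hDFX := fun k => hasMaj_idef_mulOp_farDefect_structural blk π τ τ' η⁻¹ η'⁻¹ (NV := NV k) (NV' := NV' k) (Cc := tCoefC η (gaugePair τ fun μ x => coordMat e (ContinuousLinearMap.mulLeftRight ℝ (Matrix m m ℂ) ((1 : Matrix m m ℂ) * U μ x * (1 : Matrix m m ℂ)ᴴ) ((1 : Matrix m m ℂ) * U μ x * (1 : Matrix m m ℂ)ᴴ)ᴴ)))
    (Ac := tCoefA η (gaugePair τ fun μ x => coordMat e (ContinuousLinearMap.mulLeftRight ℝ (Matrix m m ℂ) ((1 : Matrix m m ℂ) * U μ x * (1 : Matrix m m ℂ)ᴴ) ((1 : Matrix m m ℂ) * U μ x * (1 : Matrix m m ℂ)ᴴ)ᴴ)))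
    (Cc' := tCoefC η' (gaugePair τ' fun μ x' => coordMat e (ContinuousLinearMap.mulLeftRight ℝ (Matrix m m ℂ) ((1 : Matrix m m ℂ) * U' μ x' * (1 : Matrix m m ℂ)ᴴ) ((1 : Matrix m m ℂ) * U' μ x' * (1 : Matrix m m ℂ)ᴴ)ᴴ)))
    (Ac' := tCoefA η' (gaugePair τ' fun μ x' => coordMat e (ContinuousLinearMap.mulLeftRight ℝ (Matrix m m ℂ) ((1 : Matrix m m ℂ) * U' μ x' * (1 : Matrix m m ℂ)ᴴ) ((1 : Matrix m m ℂ) * U' μ x' * (1 : Matrix m m ℂ)ᴴ)ᴴ))) htri hd hrow hσ hβ hβ₁ hct hR hcr hσρ hρ₁V hρ₁G hρ₂ hρ₂₁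
    (hχt k) (hdχt k) (hdχtb k) (hsub k) (hχ k) (hs k) (hsb k) (hdd k) (hddb k) (hs2 k) (hsb2 k) (hdd2 k) (hddb2 k) (hcut k) (hcutF k) (hcutB k) (hV k) hq (hχt' k) (hdχt' k) (hdχtb' k)
    (hsub' k) (hχ' k) (hs' k) (hsb' k) (hdd' k) (hddb' k) (hs2' k) (hsb2' k) (hdd2' k) (hddb2' k) (hcut' k) (hcutF' k) (hcutB' k) (hV' k) (hhψ k) (hhψf k) ρ₃
  exact hasMaj_idef_jet_glueInv_smoothCutDressed_cubes blk π τ τ' η⁻¹ η'⁻¹ htri hd hd0 hsymm hrow hσ hcr hβ hβ₁ hct hm₀ hm₁ hoχ hoχ₁ hoχ₂ hR ho hσρ hρ₁V hρ₁G hρ₂ hρ₂₁ hρ₂T hρ₃ hρ₃₂ hρ₃V hρ₃N hσρ₃ hε hc₁ hc₂ ho₁ ho₂ hrW hθW hcN hrN hℓ hω hd₁ hoo hε₀ hrF hNov hn hn' hSχ hSψ hSχ' hSψ' hχt hdχt hdχtb hsub hχ hs hsb hdd hddb hNψ hχt' hdχt' hdχtb' hsub' hχ' hs' hsb' hdd'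 hddb' hNψ' hfitχ hfit₁ hfit₁b hfit₂ hfit₂b hcut hcutF hcutB hcut' hcutF' hcutB' hDcut hDcutF hDcutB hs2 hsb2 hdd2 hddb2 hs2' hsb2' hdd2' hddb2' hV hV' hDV hq hh1 hh1b hh1' hh1b' hh2' hf1 hf1b hf2 hLip hrh hrh' hfh hstep hstep' hDW hKN' hDKN hh2 hW hW' hKN hhabs hhabs' hhcut hhcut' hN hT hT' hDT hθF' (le_refl (0:ℝ)) hrFK' (le_refl (0:ℝ)) hcovW hcovW' hFK hFK' hFX hFX' hDFK hDFX hq' j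

end Summit.QuantumFields.YangMills.BalabanUVNodes.N15.Gluing

end
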